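import Summits.CriticalPhenomena.Ising3DConformalLimit.Theses.FKParityRobustness
import Literature.Probability.LatticeModels.GKSInequalities
import Literature.Probability.LatticeModels.PlusFreeComparison
import Literature.Probability.LatticeModels.ModifiedSimonInequality

/-!
# Disproof of `StrandShadow` (stmt-CriticalPhenomena-14626) — standing disprover's work file

Findings (cdisprove cycle 1, refuter-cdisprove-stmt-CriticalPhenomena-14626-0, 2026-08-16):

* **No kill.**  The crux is `∃ c > 0, ∀ l ≥ 1, ∃ N₀, ∀ N ≥ N₀, LHS(l,N) ≤ (1 - c)·Z·G` for the
  critical Ising model in free boxes of `ℤ³`; every quantity is a finite sum at the (non-computable)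
  `β_c(3) = sInf {…}`, so no `decide`/`norm_num` instance exists, and the `N → ∞`, `l → ∞` content
  is the open lattice clause (iii) (see COSTUME below).  Degenerate parameters do not bite:
  `l = 0` and `tanh β_c = 0` make the body `0 ≤ 0` (§3), so ANY refutation must use
  `criticalBeta_pos` (`0 < β_c(3)`, a named fact) — recorded as `strandShadow_of_tanh_criticalBeta_eq_zero`.
* **JUNK (misstatement, minor, quantified).**  `isingCorr G Λ β 0 .free {a₂,a₃}` with the depleted
  volume `Λ = {v | ¬ a₀ ↝_F v}` freezes the spins OUTSIDE `Λ` to `+1` (`BoundaryCondition.outside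
  free = 1`), so the summand of a configuration `F` whose `a₀`-cluster swallows BOTH `a₂` and `a₃`
  is `t^|F| · 1` (intended: `0`), and `t^|F| · 0` when it swallows exactly one (§1,
  `isingCorr_free_eq_inter`, `depletedCorr_eq_one_of_swallowed`, `depletedCorr_eq_zero_of_one_swallowed`,
  `lhs_decomposition`).  Hence `LHS_formal = LHS_clean + J`, `J = Σ_{F : a₂,a₃ ∈ V(K_{a₀}F)} t^|F| ≥ 0`,
  and the formal crux IMPLIES the intended one (`strandShadow_imp_clean`, §2) but is strictly
  stronger at each finite `l`.  Monte-Carlo (job j013016, pure-python SW + exact Grimmett–Janson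
  T-join sampler, this seat): at `l = 1` the junk ratio `J/(Z·G₂₃) ≈ 0.04` against a clean margin
  `1 - s_clean ≈ 0.3`, so the junk does NOT falsify the formal statement at small `l`; it decays
  like `l^{-1.5}` (tree bound `J/(Z G) ≤ 2 G(2√2 l)`).  Repair C′ = `StrandShadowClean` below
  (sum restricted to `¬ a₀ ↝ a₂ ∧ ¬ a₀ ↝ a₃`), as already proposed by the rattack seat.
  **CONSEQUENCE FOR THE PLANNER (precise):** the formal item is `C′ ∧ (∀ l ≥ 1: junk(l) < clean
  margin(l))`.  For large `l` the second conjunct follows from `G(2√2 l) → 0` (continuity at `β_c`),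
  but for the finitely many SMALL `l` it is a numerical fact about the infinite-volume critical state
  (`J/(Z G₂₃) ≈ 0.05 < 0.3` at `l = 1`, MC) that no rigorous method can certify.  So `StrandShadow`
  as formalised is (almost certainly) TRUE but NOT PROVABLE by the route's chain even granted clause
  (iii); only C′ is.  The item should be RESTATED as C′ (verbatim `StrandShadowClean`); the proved
  glue `ShadowGivesJoin` (p84491) survives the restatement with a one-line change (its proof only
  uses the clean configurations plus `isingCorr ≥ 0`), and `int_imp_strandShadowClean` /
  `strandShadow_imp_clean` here are stated for C′ already.
* **COSTUME (why it resists / why it carries nothing new).**  Exact identity (★) (finite graph,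
  any `t`): `Σ_{F₁ ∈ 𝒯₀₁, a₂,a₃ ∉ V(K₁)} t^|F₁| ⟨σ₂σ₃⟩_{G ∖ V(K₁)} = Σ_{F ∈ 𝒯_A : K_{a₀}(F) ∌ a₂,a₃} t^|F|`
  (`F₁ ↦ (K, F₁ ∖ K)` bijection + HT expansion on the depleted graph; stated as
  `PairSplitDeletionIdentity` and **PROVED** here (`pairSplitDeletionIdentity_holds`, §4a); also verified exhaustively on small graphs by the rattack seat and on the
  lattice by j013016 within errors: `s_clean` (T-join side) = `s_sym` (spin side)).  With the
  tetrahedral `S₄` symmetry of `(Λ_N, A_l)`: `s_clean(l,N) = (1 - (2/3)·Int)(1 - P_C)` EXACTLY,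
  `Int = -U₄(A_l)/(2G²) ∈ [0,1]` (Aizenman), `P_C = ℓ^A[all four joined]`; and
  `1 - Int ≤ s_clean ≤ 1 - (2/3)·Int`.  So `StrandShadowClean ⟺ INT` (`Int_N(l) ≥ c₀` uniformly)
  `⟺` the lattice clause (iii) at the tetrahedron `⟺ IndependentStrandsJoin`: the "relevant
  defect `D_HT - Δ_ε = 0.32`" mechanism is void — the shadow is an exact affine function of `U₄/G²`.
  A disproof of the crux is therefore a disproof of clause (iii) of the conjunct (open problem);
  a proof of it is a proof of clause (iii).  **KERNEL-CHECKED here (§4d, `int_imp_strandShadowClean`,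
  axioms standard): `INT → StrandShadowClean`** — the lattice clause (iii) at the tetrahedron implies
  the junk-free crux with `c ↦ (2/3)c`, via (★) + the two coordinate transpositions of the box
  (`boxPerm`, `costume_core`: `3·Z_split ≤ Z_A`, `G₀₂G₁₃ = G₀₃G₁₂ = G₀₁G₂₃`) + HT expansion.
* **LOAD-BEARING hypotheses.**  `1 ≤ l`: not load-bearing for truth (`l = 0` instance holds, §3).
  `β = β_c`: load-bearing from the HIGH-temperature side only — for `β < β_c`, `Int(l) → 0`
  exponentially (massive two-point function, straight strands on opposite edges of the tetrahedron
  miss) so the shadow ratio `→ 1` and the statement is FALSE; for `β > β_c`, `Int → 1` and it holds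
  with room.  A Lean proof of the subcritical failure needs Ornstein–Zernike-sharp two-sided bounds
  on `⟨σσ⟩_β` in growing boxes (upper bound with entropy, lower bound with entropy): not in tree;
  recorded, not attempted.
* **Numerics (j013016; l = 1..4, N = 8..24)**: see the MC block at the end — junk ≤ 0.05·G against a
  formal margin ≈ 0.3; `s_clean = s_sym` ((★) on the lattice); `Int(l) ≈ 0.47, 0.44, 0.41, 0.4`;
  `J₂ ∝ l^{-1.27}` ⇒ `dim K ≈ 1.73 = D_HT`.

PROPOSED under `Theorems/StrandShadow/Negative/` (as `--supports` files; gate/farm outage on 2026-08-16 —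
the files are attached to the item as evidence meanwhile): `FreeCorrJunk.lean` (§1–§2, def-free),
`PairSplitDeletion.lean` (§4a–§4b), `CostumeReduction.lean` (Transport/ThreeFold/§4d + the Props C′,
INT).  The degenerate-branch implication `strandShadow_of_tanh_criticalBeta_eq_zero` (positive
Theses conclusion) stays in this work file only.

HOW TO USE AT THE CRUX (instance note): the crux body carries CLASSICAL `Finset.filter` instances,
these generic lemmas constructive ones — transport with `convert … using 4` then `ext v; simp [dVol]`
(see `int_imp_strandShadowClean`); `exact`/`rw`/`change` would unfold `Finset.univ` of the box and
time out at `whnf`.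
-/

noncomputable section

namespace Summit.CriticalPhenomena.Ising3DConformalLimit.Cruxes.StrandShadow.Disproof

open scoped BigOperators Classical
open Finset
open Literature.Probability.LatticeModels
open Summit.CriticalPhenomena.Ising3DConformalLimit.Theses.FKParityRobustness (StrandShadow)

/-! ## §1 JUNK: the free finite-volume correlation ignores the sites outside the volume -/

section Junk

variable {V : Type*} (G : SimpleGraph V) [DecidableEq V] [G.LocallyFinite]

/-- Outside `Λ` the free boundary condition glues the constant `+1`, so `σ_A = σ_{A ∩ Λ}` on every
glued configuration. -/
theorem spinProduct_glue_free_inter (Λ A : Finset V) (τ : Λ → ℤˣ) :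
    spinProduct A (glue Λ τ .free) = spinProduct (A ∩ Λ) (glue Λ τ .free) := by
  unfold spinProduct
  rw [← Finset.prod_filter_mul_prod_filter_not A (· ∈ Λ)]
  have h1 : A.filter (· ∈ Λ) = A ∩ Λ := by
    ext x; simp [Finset.mem_inter]
  have h2 : ∏ x ∈ A.filter (fun x => ¬ x ∈ Λ), spinAt x (glue Λ τ .free) = 1 := by
    refine Finset.prod_eq_one fun x hx => ?_
    have hx' : x ∉ Λ := (Finset.mem_filter.1 hx).2
    simp [spinAt, glue_apply_of_notMem _ _ _ hx']
  rw [h1, h2, mul_one]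

/-- **The junk mechanism.** `⟨σ_A⟩^free_{Λ} = ⟨σ_{A ∩ Λ}⟩^free_{Λ}`: sites of `A` outside the
volume are silently dropped (their spins are frozen to `+1`). -/
theorem isingCorr_free_eq_inter (Λ : Finset V) (β h : ℝ) (A : Finset V) :
    isingCorr G Λ β h .free A = isingCorr G Λ β h .free (A ∩ Λ) := by
  rw [isingCorr, isingCorr, isingExpect, isingExpect,
    integral_isingMeasure G Λ β h .free (measurable_spinProduct A),
    integral_isingMeasure G Λ β h .free (measurable_spinProduct (A ∩ Λ))]
  congr 1
  refine Finset.sum_congr rfl fun τ _ => ?_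
  rw [spinProduct_glue_free_inter Λ A τ]

/-- `⟨σ_∅⟩ = 1`. -/
theorem isingCorr_free_empty (Λ : Finset V) (β h : ℝ) : isingCorr G Λ β h .free ∅ = 1 := by
  rw [isingCorr, isingExpect, integral_isingMeasure G Λ β h .free (measurable_spinProduct ∅)]
  simp only [spinProduct, Finset.prod_empty, mul_one]
  exact div_self (isingPartitionFunction_pos G Λ β h .free).ne'

/-- If `A` misses the volume entirely, the "correlation" is the junk value `1`. -/
theorem isingCorr_free_eq_one_of_disjoint (Λ : Finset V) (β h : ℝ) {A : Finset V}
    (hA : Disjoint A Λ) : isingCorr G Λ β h .free A = 1 := by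
  rw [isingCorr_free_eq_inter, Finset.disjoint_iff_inter_eq_empty.1 hA, isingCorr_free_empty]

/-- GKS I without the hypothesis `A ⊆ Λ` (the outside part of `A` is junk `+1`). -/
theorem isingCorr_free_nonneg (Λ : Finset V) {β h : ℝ} (hβ : 0 ≤ β) (hh : 0 ≤ h) (A : Finset V) :
    0 ≤ isingCorr G Λ β h .free A := by
  rw [isingCorr_free_eq_inter]
  exact GKSInequalities.gks_one_holds G hβ hh (Or.inl rfl) Finset.inter_subset_right

/-- One site in, one site out, zero field: the pair "correlation" is `⟨σ_y⟩^free_{Λ;β,0} = 0`. -/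
theorem isingCorr_free_pair_eq_zero (Λ : Finset V) (β : ℝ) {x y : V} (hx : x ∉ Λ) (hy : y ∈ Λ) :
    isingCorr G Λ β 0 .free {x, y} = 0 := by
  rw [isingCorr_free_eq_inter]
  have hxy : ({x, y} : Finset V) ∩ Λ = {y} := by
    ext z
    simp only [Finset.mem_inter, Finset.mem_insert, Finset.mem_singleton]
    constructor
    · rintro ⟨hz | hz, hzΛ⟩
      · exact absurd hzΛ (hz ▸ hx)
      · exact hz
    · intro hz
      exact ⟨Or.inr hz, hz ▸ hy⟩
  rw [hxy]
  exact isingCorr_free_of_odd_card_holds G Λ β (Finset.singleton_subset_iff.2 hy) (by simp)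

end Junk

/-! ### The junk inside the crux summand -/

section Summand

variable {V : Type*} [Fintype V] [DecidableEq V] (G : SimpleGraph V) [DecidableRel G.Adj]

/-- The depleted volume of the crux: the sites NOT reachable from `a₀` inside `F`. -/
def depletedVol (F : Finset (Sym2 V)) (a₀ : V) : Finset V :=
  Finset.univ.filter fun v => ¬ (SimpleGraph.fromEdgeSet (↑F : Set (Sym2 V))).Reachable a₀ v

/-- When the `a₀`-cluster of `F` swallows both `a₂` and `a₃`, the crux's depleted "correlation"
is the junk value `1` (intended value: `0`). -/
theorem depletedCorr_eq_one_of_swallowed (F : Finset (Sym2 V)) (β h : ℝ) {a₀ a₂ a₃ : V}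
    (h2 : (SimpleGraph.fromEdgeSet (↑F : Set (Sym2 V))).Reachable a₀ a₂)
    (h3 : (SimpleGraph.fromEdgeSet (↑F : Set (Sym2 V))).Reachable a₀ a₃) :
    isingCorr G (depletedVol F a₀) β h .free {a₂, a₃} = 1 := by
  apply isingCorr_free_eq_one_of_disjoint
  rw [Finset.disjoint_left]
  intro z hz
  simp only [Finset.mem_insert, Finset.mem_singleton] at hz
  simp only [depletedVol, Finset.mem_filter, Finset.mem_univ, true_and, not_not]
  rcases hz with rfl | rfl <;> assumption

/-- When the `a₀`-cluster swallows exactly one of `a₂, a₃` (zero field) the depleted correlation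
is `0` — here the junk and the intended value agree. -/
theorem depletedCorr_eq_zero_of_one_swallowed (F : Finset (Sym2 V)) (β : ℝ) {a₀ a₂ a₃ : V}
    (h2 : (SimpleGraph.fromEdgeSet (↑F : Set (Sym2 V))).Reachable a₀ a₂)
    (h3 : ¬ (SimpleGraph.fromEdgeSet (↑F : Set (Sym2 V))).Reachable a₀ a₃) :
    isingCorr G (depletedVol F a₀) β 0 .free {a₂, a₃} = 0 := by
  apply isingCorr_free_pair_eq_zero
  · simp [depletedVol, h2]
  · simp [depletedVol, h3]

/-- Symmetric version of `depletedCorr_eq_zero_of_one_swallowed`. -/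
theorem depletedCorr_eq_zero_of_one_swallowed' (F : Finset (Sym2 V)) (β : ℝ) {a₀ a₂ a₃ : V}
    (h2 : ¬ (SimpleGraph.fromEdgeSet (↑F : Set (Sym2 V))).Reachable a₀ a₂)
    (h3 : (SimpleGraph.fromEdgeSet (↑F : Set (Sym2 V))).Reachable a₀ a₃) :
    isingCorr G (depletedVol F a₀) β 0 .free {a₂, a₃} = 0 := by
  rw [Finset.pair_comm]
  exact depletedCorr_eq_zero_of_one_swallowed G F β h3 h2

/-- **LHS decomposition.** For any family `𝒯` of configurations, zero field and `t`:
`Σ_{F ∈ 𝒯} t^|F| ⟨σ₂σ₃⟩_{depl F} = Σ_{F ∈ 𝒯, clean} t^|F| ⟨σ₂σ₃⟩_{depl F} + Σ_{F ∈ 𝒯, both swallowed} t^|F|`,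
"clean" = neither `a₂` nor `a₃` swallowed.  The second sum is the JUNK term `J ≥ 0`. -/
theorem lhs_decomposition (𝒯 : Finset (Finset (Sym2 V))) (t β : ℝ) (a₀ a₂ a₃ : V) :
    (∑ F ∈ 𝒯, t ^ F.card * isingCorr G (depletedVol F a₀) β 0 .free {a₂, a₃}) =
      (∑ F ∈ 𝒯.filter (fun F : Finset (Sym2 V) => ¬ (SimpleGraph.fromEdgeSet (↑F : Set (Sym2 V))).Reachable a₀ a₂ ∧
          ¬ (SimpleGraph.fromEdgeSet (↑F : Set (Sym2 V))).Reachable a₀ a₃),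
        t ^ F.card * isingCorr G (depletedVol F a₀) β 0 .free {a₂, a₃}) +
      ∑ F ∈ 𝒯.filter (fun F : Finset (Sym2 V) => (SimpleGraph.fromEdgeSet (↑F : Set (Sym2 V))).Reachable a₀ a₂ ∧
          (SimpleGraph.fromEdgeSet (↑F : Set (Sym2 V))).Reachable a₀ a₃), t ^ F.card := by
  set R : Finset (Sym2 V) → V → Prop := fun F v =>
    (SimpleGraph.fromEdgeSet (↑F : Set (Sym2 V))).Reachable a₀ v with hR
  set f : Finset (Sym2 V) → ℝ := fun F => t ^ F.card * isingCorr G (depletedVol F a₀) β 0 .free {a₂, a₃}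
    with hf
  -- split 𝒯 into clean / not clean
  rw [← Finset.sum_filter_add_sum_filter_not 𝒯 (fun F => ¬ R F a₂ ∧ ¬ R F a₃) f]
  congr 1
  -- on the complement: either both swallowed (summand = t^|F|) or exactly one (summand = 0)
  rw [← Finset.sum_filter_add_sum_filter_not (𝒯.filter fun F => ¬(¬ R F a₂ ∧ ¬ R F a₃))
    (fun F => R F a₂ ∧ R F a₃) f]
  have hboth : (𝒯.filter fun F => ¬(¬ R F a₂ ∧ ¬ R F a₃)).filter (fun F => R F a₂ ∧ R F a₃) =
      𝒯.filter (fun F => R F a₂ ∧ R F a₃) := by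
    ext F; simp only [Finset.mem_filter]; tauto
  have hzero : ∑ F ∈ (𝒯.filter fun F => ¬(¬ R F a₂ ∧ ¬ R F a₃)).filter (fun F => ¬ (R F a₂ ∧ R F a₃)),
      f F = 0 := by
    refine Finset.sum_eq_zero fun F hF => ?_
    simp only [Finset.mem_filter] at hF
    obtain ⟨⟨_, hF1⟩, hF2⟩ := hF
    by_cases h2 : R F a₂
    · have h3 : ¬ R F a₃ := fun h3 => hF2 ⟨h2, h3⟩
      simp only [hf, hR] at h2 h3 ⊢
      rw [depletedCorr_eq_zero_of_one_swallowed G F β h2 h3, mul_zero]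
    · have h3 : R F a₃ := by
        by_contra h3; exact hF1 ⟨h2, h3⟩
      simp only [hf, hR] at h2 h3 ⊢
      rw [depletedCorr_eq_zero_of_one_swallowed' G F β h2 h3, mul_zero]
  rw [hzero, add_zero, hboth]
  refine Finset.sum_congr rfl fun F hF => ?_
  simp only [Finset.mem_filter] at hF
  simp only [hf]
  rw [depletedCorr_eq_one_of_swallowed G F β 0 hF.2.1 hF.2.2, mul_one]

/-- The junk term is nonnegative for `t ≥ 0`, so dropping it only LOWERS the left side. -/
theorem junk_nonneg (𝒯 : Finset (Finset (Sym2 V))) {t : ℝ} (ht : 0 ≤ t) (a₀ a₂ a₃ : V) :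
    0 ≤ ∑ F ∈ 𝒯.filter (fun F : Finset (Sym2 V) => (SimpleGraph.fromEdgeSet (↑F : Set (Sym2 V))).Reachable a₀ a₂ ∧
          (SimpleGraph.fromEdgeSet (↑F : Set (Sym2 V))).Reachable a₀ a₃), t ^ F.card :=
  Finset.sum_nonneg fun _ _ => pow_nonneg ht _

end Summand

/-! ## §2 The clean repair C′ and `StrandShadow → StrandShadowClean` -/

/-- **C′ (repaired crux, = the INTENDED statement).** Same frame as `StrandShadow`, the sum
restricted to the configurations whose `a₀`-cluster swallows neither `a₂` nor `a₃` (for the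
others the intended depleted correlation is `0`).  Proposed by the rattack seat; elaborates. -/
def StrandShadowClean : Prop :=
  let tetra : Fin 4 → Site 3 := ![![-1, -1, -1], ![1, 1, -1], ![1, -1, 1], ![-1, 1, 1]]
  ∃ c : ℝ, 0 < c ∧ ∀ l : ℕ, 1 ≤ l → ∃ N₀ : ℕ, ∀ N : ℕ, N₀ ≤ N → ∀ a : Fin 4 → ↥(box 3 N),
    (∀ i, ((a i : Site 3)) = (l : ℤ) • tetra i) →
    (let G := (zdGraph 3).comap (Subtype.val : ↥(box 3 N) → Site 3)
     let β : ℝ := criticalBeta 3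
     let t : ℝ := Real.tanh β
     (∑ F ∈ (tJoins G Set.univ {a 0, a 1}).filter (fun F : Finset (Sym2 ↥(box 3 N)) =>
          ¬ (SimpleGraph.fromEdgeSet (↑F : Set (Sym2 ↥(box 3 N)))).Reachable (a 0) (a 2) ∧
          ¬ (SimpleGraph.fromEdgeSet (↑F : Set (Sym2 ↥(box 3 N)))).Reachable (a 0) (a 3)),
        t ^ F.card * isingCorr G (Finset.univ.filter (fun v : ↥(box 3 N) =>
          ¬ (SimpleGraph.fromEdgeSet (↑F : Set (Sym2 ↥(box 3 N)))).Reachable (a 0) v)) β 0 .free {a 2, a 3})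
      ≤ (1 - c) * loopO1PartitionFunction G t {a 0, a 1} * isingCorr G Finset.univ β 0 .free {a 2, a 3})

/-- `tanh β_c(3) ≥ 0` (from `criticalBeta_nonneg`). -/
theorem tanh_criticalBeta_nonneg : 0 ≤ Real.tanh (criticalBeta 3) := by
  rw [Real.tanh_eq_sinh_div_cosh]
  exact div_nonneg (Real.sinh_nonneg_iff.2 (criticalBeta_nonneg 3)) (Real.cosh_pos _).le

/-- **The formal crux implies the intended one** (it is STRONGER by the junk term `J ≥ 0`). -/
theorem strandShadow_imp_clean : StrandShadow → StrandShadowClean := by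
  rintro ⟨c, hc, h⟩
  refine ⟨c, hc, fun l hl => ?_⟩
  obtain ⟨N₀, hN⟩ := h l hl
  refine ⟨N₀, fun N hNN a ha => ?_⟩
  have key := hN N hNN a ha
  simp only at key ⊢
  refine le_trans ?_ key
  apply Finset.sum_le_sum_of_subset_of_nonneg (Finset.filter_subset _ _)
  intro F _ _
  refine mul_nonneg (pow_nonneg tanh_criticalBeta_nonneg _) ?_
  exact isingCorr_free_nonneg _ _ (criticalBeta_nonneg 3) le_rfl _

/-! ## §3 Degenerate parameters give no counterexample -/

section Degenerate

variable {V : Type*} [Fintype V] [DecidableEq V] (G : SimpleGraph V) [DecidableRel G.Adj]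

/-- Handshake for edge sets of a simple graph: the number of odd-degree vertices is even, so a
`T`-join has an even terminal set. -/
theorem even_card_of_mem_tJoins {ω : Set (Sym2 V)} {A : Finset V} {F : Finset (Sym2 V)}
    (hF : F ∈ tJoins G ω A) : Even A.card := by
  rw [mem_tJoins] at hF
  obtain ⟨hFG, -, hodd⟩ := hF
  -- degree sum = 2 |F|
  have hdiag : ∀ e ∈ F, ¬ e.IsDiag := fun e he =>
    SimpleGraph.not_isDiag_of_mem_edgeSet G (SimpleGraph.mem_edgeFinset.1 (hFG he))
  have htwo : ∀ e ∈ F, (Finset.univ.filter fun v : V => v ∈ e).card = 2 := by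
    intro e he
    induction e using Sym2.ind with
    | _ x y =>
      have hxy : x ≠ y := fun h => hdiag _ he (by simp [h])
      rw [Finset.card_eq_two]
      exact ⟨x, y, hxy, by ext v; simp [Sym2.mem_iff]⟩
  have hsum : ∑ v, (F.filter (v ∈ ·)).card = 2 * F.card := by
    simp_rw [Finset.card_filter]
    rw [Finset.sum_comm]
    simp_rw [← Finset.card_filter]
    rw [Finset.sum_congr rfl htwo, Finset.sum_const, smul_eq_mul, mul_comm]
  have heven : Even (∑ v, (F.filter (v ∈ ·)).card) := ⟨F.card, by rw [hsum]; ring⟩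
  rw [Finset.even_sum_iff_even_card_odd] at heven
  have hA : (Finset.univ.filter fun v => Odd (F.filter (v ∈ ·)).card) = A := by
    ext v; simp [hodd v]
  rwa [hA] at heven

/-- An odd terminal set has no `T`-join. -/
theorem tJoins_eq_empty_of_odd {ω : Set (Sym2 V)} {A : Finset V} (hA : Odd A.card) :
    tJoins G ω A = ∅ := by
  rw [Finset.eq_empty_iff_forall_notMem]
  intro F hF
  exact (Nat.not_even_iff_odd.2 hA) (even_card_of_mem_tJoins G hF)

/-- With a singleton terminal set the sourced partition function vanishes. -/
theorem loopO1PartitionFunction_singleton (t : ℝ) (x : V) :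
    loopO1PartitionFunction G t {x} = 0 := by
  unfold loopO1PartitionFunction loopO1Weight
  refine Finset.sum_eq_zero fun F _ => ?_
  rw [tJoins_eq_empty_of_odd G (by simp)]
  simp

/-- A `T`-join with a NONEMPTY terminal set is a nonempty edge set. -/
theorem card_pos_of_mem_tJoins {ω : Set (Sym2 V)} {A : Finset V} {F : Finset (Sym2 V)}
    (hF : F ∈ tJoins G ω A) {x : V} (hx : x ∈ A) : 0 < F.card := by
  rw [mem_tJoins] at hF
  obtain ⟨-, -, hodd⟩ := hF
  have h := (hodd x).2 hx
  have hne : (F.filter (x ∈ ·)).card ≠ 0 := fun h0 => by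
    rw [h0] at h; exact Nat.not_odd_zero h
  exact Nat.pos_of_ne_zero fun hF0 => hne (by
    rw [Finset.card_eq_zero] at hF0 ⊢; rw [hF0]; rfl)

/-- At `t = 0` every sourced sum with a nonempty terminal set vanishes. -/
theorem sum_tJoins_pow_zero_mul {ω : Set (Sym2 V)} {A : Finset V} {x : V} (hx : x ∈ A)
    (g : Finset (Sym2 V) → ℝ) :
    ∑ F ∈ tJoins G ω A, (0 : ℝ) ^ F.card * g F = 0 := by
  refine Finset.sum_eq_zero fun F hF => ?_
  rw [zero_pow (card_pos_of_mem_tJoins G hF hx).ne', zero_mul]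

/-- At `t = 0` the sourced partition function with a nonempty terminal set vanishes. -/
theorem loopO1PartitionFunction_zero_of_mem (A : Finset V) {x : V} (hx : x ∈ A) :
    loopO1PartitionFunction G 0 A = 0 := by
  unfold loopO1PartitionFunction loopO1Weight
  refine Finset.sum_eq_zero fun F _ => ?_
  split_ifs with hF
  · exact zero_pow (card_pos_of_mem_tJoins G hF hx).ne'
  · rfl

/-- The sourced partition function is the plain sum over `T`-joins (bridge between the crux's
`loopO1PartitionFunction` factor and the `tJoins` sums used everywhere else). -/
theorem loopO1PartitionFunction_eq_sum_tJoins (t : ℝ) (A : Finset V) :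
    loopO1PartitionFunction G t A = ∑ F ∈ tJoins G Set.univ A, t ^ F.card := by
  unfold loopO1PartitionFunction loopO1Weight
  rw [← Finset.sum_filter]
  congr 1
  ext F
  simp only [mem_filter, mem_powerset, and_iff_right_iff_imp]
  intro hF
  exact (mem_tJoins G).1 hF |>.1

end Degenerate

/-- **Degenerate instance `l = 0`** (dropping `1 ≤ l`): all four vertices coincide, the terminal
set `{a 0, a 1}` is a singleton, both sides vanish and the body holds for EVERY `c`.  So `1 ≤ l`
is not load-bearing for truth; it only excludes a vacuous instance. -/
theorem body_holds_at_l_zero (c : ℝ) (N : ℕ) (a : Fin 4 → ↥(box 3 N))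
    (ha : ∀ i, ((a i : Site 3)) = (0 : ℤ) • (![![-1, -1, -1], ![1, 1, -1], ![1, -1, 1], ![-1, 1, 1]] : Fin 4 → Site 3) i) :
    (let G := (zdGraph 3).comap (Subtype.val : ↥(box 3 N) → Site 3)
     let β : ℝ := criticalBeta 3
     let t : ℝ := Real.tanh β
     (∑ F ∈ tJoins G Set.univ {a 0, a 1}, t ^ F.card * isingCorr G (Finset.univ.filter
        (fun v : ↥(box 3 N) => ¬ (SimpleGraph.fromEdgeSet (↑F : Set (Sym2 ↥(box 3 N)))).Reachable (a 0) v)) β 0 .free {a 2, a 3})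
      ≤ (1 - c) * loopO1PartitionFunction G t {a 0, a 1} * isingCorr G Finset.univ β 0 .free {a 2, a 3}) := by
  have h01 : a 0 = a 1 := by
    apply Subtype.ext; rw [ha 0, ha 1]; simp
  simp only [h01, Finset.pair_eq_singleton]
  rw [tJoins_eq_empty_of_odd _ (by simp), Finset.sum_empty, loopO1PartitionFunction_singleton]
  simp

/-- **Degenerate branch `tanh β_c = 0`**: then both sides vanish for every `l ≥ 1` and the crux
holds (with `c = 1/2`).  Consequently ANY refutation of `StrandShadow` must use `0 < β_c(3)`
(`criticalBeta_pos`, crit-ising.S07).  (Positive conclusion: kept in this work file only.) -/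
theorem strandShadow_of_tanh_criticalBeta_eq_zero (h0 : Real.tanh (criticalBeta 3) = 0) :
    StrandShadow := by
  refine ⟨1 / 2, by norm_num, fun l hl => ⟨0, fun N _ a ha => ?_⟩⟩
  simp only
  have hmem : a 0 ∈ ({a 0, a 1} : Finset ↥(box 3 N)) := by simp
  rw [h0, sum_tJoins_pow_zero_mul _ hmem, loopO1PartitionFunction_zero_of_mem _ _ hmem]
  simp

/-! ## §4 COSTUME: the exact pairing-deletion identity behind `s_clean = (1 - (2/3)Int)(1 - P_C)` -/

/-! ### §4a The cluster decomposition `F ↦ (K, F ∖ K)` and the proof of (★) -/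

section Graph

variable {V : Type*} [DecidableEq V]

/-- Reachability from `x` inside the edge finset `F`. -/
abbrev Rch (F : Finset (Sym2 V)) (x v : V) : Prop :=
  (SimpleGraph.fromEdgeSet (↑F : Set (Sym2 V))).Reachable x v

omit [DecidableEq V] in
theorem rch_refl (F : Finset (Sym2 V)) (x : V) : Rch F x x := SimpleGraph.Reachable.refl x

omit [DecidableEq V] in
theorem rch_mono {F F' : Finset (Sym2 V)} (h : F ⊆ F') {x v : V} (hr : Rch F x v) : Rch F' x v :=
  SimpleGraph.Reachable.mono (SimpleGraph.fromEdgeSet_mono (Finset.coe_subset.2 h)) hr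

theorem rch_step {F : Finset (Sym2 V)} {x u v : V} {e : Sym2 V} (he : e ∈ F) (hu : u ∈ e)
    (hv : v ∈ e) (hxu : Rch F x u) : Rch F x v := by
  by_cases huv : u = v
  · exact huv ▸ hxu
  · have hadj : (SimpleGraph.fromEdgeSet (↑F : Set (Sym2 V))).Adj u v := by
      rw [SimpleGraph.fromEdgeSet_adj]
      refine ⟨?_, huv⟩
      have : e = s(u, v) := (Sym2.mem_and_mem_iff huv).1 ⟨hu, hv⟩
      rw [← this]
      exact Finset.mem_coe.2 he
    exact SimpleGraph.Reachable.trans hxu hadj.reachable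

/-- Adding edges none of whose endpoints is `K`-reachable from `x` does not change what is
reachable from `x`. -/
theorem rch_union_iff {K R : Finset (Sym2 V)} {x : V} (hR : ∀ e ∈ R, ∀ v ∈ e, ¬ Rch K x v)
    (v : V) : Rch (K ∪ R) x v ↔ Rch K x v := by
  refine ⟨fun h => ?_, rch_mono subset_union_left⟩
  unfold Rch at h
  rw [SimpleGraph.reachable_iff_reflTransGen] at h
  induction h with
  | refl => exact rch_refl K x
  | tail _ hbc ih =>
    rw [SimpleGraph.fromEdgeSet_adj] at hbc
    obtain ⟨hmem, _⟩ := hbc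
    rcases Finset.mem_union.1 (Finset.mem_coe.1 hmem) with hK | hRR
    · exact rch_step hK (Sym2.mem_mk_left _ _) (Sym2.mem_mk_right _ _) ih
    · exact absurd ih (hR _ hRR _ (Sym2.mem_mk_left _ _))

/-- The edges of `F` in the `F`-component of `x` (both endpoints reachable; one suffices). -/
def clusterEdges (F : Finset (Sym2 V)) (x : V) : Finset (Sym2 V) :=
  F.filter fun e => ∃ v ∈ e, Rch F x v

omit [DecidableEq V] in
theorem clusterEdges_subset (F : Finset (Sym2 V)) (x : V) : clusterEdges F x ⊆ F :=
  filter_subset _ _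

theorem sdiff_clusterEdges_avoid (F : Finset (Sym2 V)) (x : V) :
    ∀ e ∈ F \ clusterEdges F x, ∀ v ∈ e, ¬ Rch (clusterEdges F x) x v := by
  intro e he v hv hr
  rw [mem_sdiff, clusterEdges, mem_filter] at he
  exact he.2 ⟨he.1, v, hv, rch_mono (clusterEdges_subset F x) hr⟩

theorem rch_clusterEdges_iff (F : Finset (Sym2 V)) (x v : V) :
    Rch (clusterEdges F x) x v ↔ Rch F x v := by
  have h := rch_union_iff (sdiff_clusterEdges_avoid F x) v
  rw [union_sdiff_of_subset (clusterEdges_subset F x)] at h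
  exact h.symm

theorem clusterEdges_idem (F : Finset (Sym2 V)) (x : V) :
    clusterEdges (clusterEdges F x) x = clusterEdges F x := by
  ext e
  constructor
  · intro h
    exact (mem_filter.1 h).1
  · intro h
    have h' := h
    rw [clusterEdges, mem_filter] at h'
    obtain ⟨_, v, hv, hr⟩ := h'
    exact mem_filter.2 ⟨h, v, hv, (rch_clusterEdges_iff F x v).2 hr⟩

theorem clusterEdges_union_eq {K R : Finset (Sym2 V)} {x : V} (hK : clusterEdges K x = K)
    (hR : ∀ e ∈ R, ∀ v ∈ e, ¬ Rch K x v) : clusterEdges (K ∪ R) x = K := by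
  ext e
  rw [clusterEdges, mem_filter, mem_union]
  simp_rw [rch_union_iff hR]
  constructor
  · rintro ⟨hKR | hRR, v, hv, hr⟩
    · exact hKR
    · exact absurd hr (hR e hRR v hv)
  · intro he
    refine ⟨Or.inl he, ?_⟩
    have he' : e ∈ clusterEdges K x := by rw [hK]; exact he
    exact (mem_filter.1 he').2

/-- Every endpoint of an edge of a self-clustered `K` is reachable. -/
theorem rch_of_mem_of_self {K : Finset (Sym2 V)} {x : V} (hK : clusterEdges K x = K)
    {e : Sym2 V} (he : e ∈ K) {v : V} (hv : v ∈ e) : Rch K x v := by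
  have he' : e ∈ clusterEdges K x := by rw [hK]; exact he
  obtain ⟨-, u, hu, hxu⟩ := mem_filter.1 he'
  exact rch_step he hu hv hxu

/-- `F`-degree of a vertex in an edge finset. -/
def edeg (F : Finset (Sym2 V)) (v : V) : ℕ := #(F.filter fun e => v ∈ e)

theorem edeg_union {K R : Finset (Sym2 V)} (h : Disjoint K R) (v : V) :
    edeg (K ∪ R) v = edeg K v + edeg R v := by
  unfold edeg
  rw [filter_union, card_union_of_disjoint (disjoint_filter_filter h)]

theorem edeg_eq_zero_of_avoid {R : Finset (Sym2 V)} {v : V} (h : ∀ e ∈ R, v ∉ e) : edeg R v = 0 := by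
  unfold edeg
  rw [card_eq_zero, filter_eq_empty_iff]
  exact fun e he => h e he

theorem edeg_eq_zero_of_not_rch {K : Finset (Sym2 V)} {x v : V} (hK : clusterEdges K x = K)
    (hv : ¬ Rch K x v) : edeg K v = 0 :=
  edeg_eq_zero_of_avoid fun _ he hve => hv (rch_of_mem_of_self hK he hve)

theorem rch_of_edeg_ne_zero {K : Finset (Sym2 V)} {x v : V} (hK : clusterEdges K x = K)
    (hv : edeg K v ≠ 0) : Rch K x v := by
  by_contra h
  exact hv (edeg_eq_zero_of_not_rch hK h)

/-- A self-clustered `K` is disjoint from any edge set avoiding its reachable vertices. -/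
theorem disjoint_of_avoid {K R : Finset (Sym2 V)} {x : V} (hK : clusterEdges K x = K)
    (hR : ∀ e ∈ R, ∀ v ∈ e, ¬ Rch K x v) : Disjoint K R := by
  rw [Finset.disjoint_left]
  intro e heK heR
  induction e using Sym2.ind with
  | _ a b => exact hR _ heR a (Sym2.mem_mk_left a b) (rch_of_mem_of_self hK heK (Sym2.mem_mk_left a b))

/-- Handshake: an edge finset without diagonal edges has an even number of odd vertices. -/
theorem even_card_odd_edeg [Fintype V] {F : Finset (Sym2 V)} (hdiag : ∀ e ∈ F, ¬ e.IsDiag) :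
    Even #(univ.filter fun v => Odd (edeg F v)) := by
  have htwo : ∀ e ∈ F, (Finset.univ.filter fun v : V => v ∈ e).card = 2 := by
    intro e he
    induction e using Sym2.ind with
    | _ a b =>
      have hab : a ≠ b := fun h => hdiag _ he (by simp [h])
      rw [Finset.card_eq_two]
      exact ⟨a, b, hab, by ext v; simp [Sym2.mem_iff]⟩
  have hsum : ∑ v, edeg F v = 2 * F.card := by
    unfold edeg
    simp_rw [Finset.card_filter]
    rw [Finset.sum_comm]
    simp_rw [← Finset.card_filter]
    rw [Finset.sum_congr rfl htwo, Finset.sum_const, smul_eq_mul, mul_comm]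
  have heven : Even (∑ v, edeg F v) := ⟨F.card, by rw [hsum]; ring⟩
  rwa [Finset.even_sum_iff_even_card_odd] at heven

end Graph

/-! ### The fibre bijection `F ↦ F ∖ K`, `R ↦ K ∪ R` over a fixed self-clustered `K` -/

section Fibre

variable {V : Type*} [Fintype V] [DecidableEq V] (G : SimpleGraph V) [DecidableRel G.Adj]

/-- Depleted volume: vertices not `K`-reachable from `x`. -/
def dVol (K : Finset (Sym2 V)) (x : V) : Finset V := univ.filter fun v => ¬ Rch K x v

theorem mem_dVol {K : Finset (Sym2 V)} {x v : V} : v ∈ dVol K x ↔ ¬ Rch K x v := by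
  simp [dVol]

theorem dVol_union_eq {K R : Finset (Sym2 V)} {x : V} (hR : ∀ e ∈ R, ∀ v ∈ e, ¬ Rch K x v) :
    dVol (K ∪ R) x = dVol K x := by
  ext v; simp only [dVol, mem_filter, mem_univ, true_and, rch_union_iff hR]

/-- `tJoins G univ S` membership in terms of `edeg`. -/
theorem mem_tJoins_univ {S : Finset V} {F : Finset (Sym2 V)} :
    F ∈ tJoins G Set.univ S ↔ F ⊆ G.edgeFinset ∧ ∀ v, Odd (edeg F v) ↔ v ∈ S := by
  rw [mem_tJoins]
  simp only [Set.subset_univ, true_and]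
  rfl

/-- **Fibre sum.** Fix a self-clustered `K ⊆ E(G)` at `x` with odd set `S₀` and a terminal set
`T` inside the depleted volume `Λ = dVol K x`.  Then `F ↦ F ∖ K` is a bijection from
`{F ∈ 𝒯_{S₀ ∪ T}(G) : clusterEdges F x = K}` onto `{R ⊆ edgesIn G Λ : oddVerts Λ R = T}`, with
inverse `R ↦ K ∪ R`. -/
theorem fibre_sum {K : Finset (Sym2 V)} {x : V} {S₀ T : Finset V} (hKG : K ⊆ G.edgeFinset)
    (hKself : clusterEdges K x = K) (hKodd : ∀ v, Odd (edeg K v) ↔ v ∈ S₀)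
    (hT : T ⊆ dVol K x) (g : Finset (Sym2 V) → ℝ) :
    ∑ F ∈ (tJoins G Set.univ (S₀ ∪ T)).filter (fun F => clusterEdges F x = K), g F =
      ∑ R ∈ (edgesIn G (dVol K x)).powerset.filter (fun R => oddVerts (dVol K x) R = T),
        g (K ∪ R) := by
  -- vertices of S₀ are reachable
  have hS₀ : ∀ v ∈ S₀, Rch K x v := fun v hv =>
    rch_of_edeg_ne_zero hKself (fun h0 => by
      have := (hKodd v).2 hv; rw [h0] at this; exact Nat.not_odd_zero this)
  refine Finset.sum_bij' (fun F _ => F \ K) (fun R _ => K ∪ R) ?_ ?_ ?_ ?_ ?_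
  · -- hi : F ↦ F \ K lands in the even/T-subgraphs of the depleted volume
    intro F hF
    rw [mem_filter] at hF
    obtain ⟨hF, hcl⟩ := hF
    rw [mem_tJoins_univ] at hF
    obtain ⟨hFG, hFodd⟩ := hF
    have havoid : ∀ e ∈ F \ K, ∀ v ∈ e, ¬ Rch K x v := by
      have := sdiff_clusterEdges_avoid F x
      rw [hcl] at this
      exact this
    have hdisj : Disjoint K (F \ K) := disjoint_sdiff
    have hKF : K ⊆ F := by rw [← hcl]; exact clusterEdges_subset F x
    rw [mem_filter, mem_powerset]
    refine ⟨fun e he => ?_, ?_⟩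
    · rw [mem_edgesIn_iff]
      refine ⟨SimpleGraph.mem_edgeFinset.1 (hFG (mem_sdiff.1 he).1), fun v hv => ?_⟩
      exact mem_dVol.2 (havoid e he v hv)
    · ext v
      rw [oddVerts, mem_filter, mem_dVol]
      constructor
      · rintro ⟨hv, hodd⟩
        have hdeg : edeg F v = edeg K v + edeg (F \ K) v := by
          rw [← edeg_union hdisj, union_sdiff_of_subset hKF]
        rw [edeg_eq_zero_of_not_rch hKself hv, zero_add] at hdeg
        have hodd' : Odd (edeg F v) := by rw [hdeg]; exact hodd
        have hvS := (hFodd v).1 hodd'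
        rcases mem_union.1 hvS with h | h
        · exact absurd (hS₀ v h) hv
        · exact h
      · intro hvT
        have hv : ¬ Rch K x v := mem_dVol.1 (hT hvT)
        refine ⟨hv, ?_⟩
        have hdeg : edeg F v = edeg K v + edeg (F \ K) v := by
          rw [← edeg_union hdisj, union_sdiff_of_subset hKF]
        rw [edeg_eq_zero_of_not_rch hKself hv, zero_add] at hdeg
        have h1 : Odd (edeg F v) := (hFodd v).2 (mem_union_right _ hvT)
        rw [hdeg] at h1
        exact h1
  · -- hj : R ↦ K ∪ R lands in the fibre
    intro R hR
    rw [mem_filter, mem_powerset] at hR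
    obtain ⟨hRE, hRodd⟩ := hR
    have havoid : ∀ e ∈ R, ∀ v ∈ e, ¬ Rch K x v := fun e he v hv =>
      mem_dVol.1 ((mem_edgesIn_iff.1 (hRE he)).2 v hv)
    have hdisj : Disjoint K R := by
      rw [Finset.disjoint_left]
      intro e heK heR
      induction e using Sym2.ind with
      | _ a b => exact havoid _ heR a (Sym2.mem_mk_left a b) (rch_of_mem_of_self hKself heK (Sym2.mem_mk_left a b))
    rw [mem_filter, mem_tJoins_univ]
    refine ⟨⟨?_, fun v => ?_⟩, clusterEdges_union_eq hKself havoid⟩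
    · intro e he
      rcases mem_union.1 he with h | h
      · exact hKG h
      · exact SimpleGraph.mem_edgeFinset.2 (mem_edgesIn_iff.1 (hRE h)).1
    · rw [edeg_union hdisj]
      by_cases hv : Rch K x v
      · have h0 : edeg R v = 0 := edeg_eq_zero_of_avoid fun e he hve => havoid e he v hve hv
        rw [h0, add_zero, hKodd v, mem_union]
        constructor
        · exact Or.inl
        · rintro (h | h)
          · exact h
          · exact absurd hv (mem_dVol.1 (hT h))
      · rw [edeg_eq_zero_of_not_rch hKself hv, zero_add, mem_union]
        have hvΛ : v ∈ dVol K x := mem_dVol.2 hv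
        have key : Odd (edeg R v) ↔ v ∈ T := by
          rw [← hRodd, oddVerts, mem_filter]
          exact ⟨fun h => ⟨hvΛ, h⟩, fun h => h.2⟩
        rw [key]
        constructor
        · exact Or.inr
        · rintro (h | h)
          · exact absurd (hS₀ v h) hv
          · exact h
  · -- left inverse
    intro F hF
    rw [mem_filter] at hF
    have hKF : K ⊆ F := by rw [← hF.2]; exact clusterEdges_subset F x
    exact union_sdiff_of_subset hKF
  · -- right inverse
    intro R hR
    rw [mem_filter, mem_powerset] at hR
    have havoid : ∀ e ∈ R, ∀ v ∈ e, ¬ Rch K x v := fun e he v hv =>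
      mem_dVol.1 ((mem_edgesIn_iff.1 (hR.1 he)).2 v hv)
    have hdisj : Disjoint K R := by
      rw [Finset.disjoint_left]
      intro e heK heR
      induction e using Sym2.ind with
      | _ a b => exact havoid _ heR a (Sym2.mem_mk_left a b) (rch_of_mem_of_self hKself heK (Sym2.mem_mk_left a b))
    exact union_sdiff_cancel_left hdisj
  · -- summand
    intro F hF
    rw [mem_filter] at hF
    have hKF : K ⊆ F := by rw [← hF.2]; exact clusterEdges_subset F x
    rw [union_sdiff_of_subset hKF]

end Fibre

/-! ### Assembly of (★) -/

section Assembly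

variable {V : Type*} [Fintype V] [DecidableEq V] (G : SimpleGraph V) [DecidableRel G.Adj]

/-- The cluster index set: self-clustered `K ⊆ E(G)` at `a₀` with odd set `{a₀, a₁}`, reaching
neither `a₂` nor `a₃`. -/
def clusterIndex (a₀ a₁ a₂ a₃ : V) : Finset (Finset (Sym2 V)) :=
  (G.edgeFinset.powerset).filter fun K => clusterEdges K a₀ = K ∧
    (∀ v, Odd (edeg K v) ↔ v ∈ ({a₀, a₁} : Finset V)) ∧ ¬ Rch K a₀ a₂ ∧ ¬ Rch K a₀ a₃

theorem mem_clusterIndex {a₀ a₁ a₂ a₃ : V} {K : Finset (Sym2 V)} :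
    K ∈ clusterIndex G a₀ a₁ a₂ a₃ ↔ K ⊆ G.edgeFinset ∧ clusterEdges K a₀ = K ∧
      (∀ v, Odd (edeg K v) ↔ v ∈ ({a₀, a₁} : Finset V)) ∧ ¬ Rch K a₀ a₂ ∧ ¬ Rch K a₀ a₃ := by
  rw [clusterIndex, mem_filter, mem_powerset]

omit [Fintype V] in
/-- Parity transfer between `F` and its `a₀`-cluster at a reachable vertex. -/
theorem odd_edeg_clusterEdges_iff {F : Finset (Sym2 V)} {a₀ v : V} (hv : Rch F a₀ v) :
    Odd (edeg (clusterEdges F a₀) v) ↔ Odd (edeg F v) := by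
  have hsplit : edeg F v = edeg (clusterEdges F a₀) v + edeg (F \ clusterEdges F a₀) v := by
    rw [← edeg_union disjoint_sdiff, union_sdiff_of_subset (clusterEdges_subset F a₀)]
  have h0 : edeg (F \ clusterEdges F a₀) v = 0 :=
    edeg_eq_zero_of_avoid fun e he hve =>
      sdiff_clusterEdges_avoid F a₀ e he v hve ((rch_clusterEdges_iff F a₀ v).2 hv)
  rw [hsplit, h0, add_zero]

omit [Fintype V] in
theorem edeg_clusterEdges_eq_zero {F : Finset (Sym2 V)} {a₀ v : V} (hv : ¬ Rch F a₀ v) :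
    edeg (clusterEdges F a₀) v = 0 :=
  edeg_eq_zero_of_not_rch (clusterEdges_idem F a₀) (by rwa [rch_clusterEdges_iff])

/-- In a `T`-join whose terminals other than `a₀, a₁` are unreachable from `a₀`, the terminal
`a₁` IS reachable (handshake inside the `a₀`-cluster). -/
theorem rch_a1 {S' : Finset V} {a₀ a₁ : V} (ha₀ : a₀ ∈ S') {F : Finset (Sym2 V)}
    (hS' : ∀ v ∈ S', Rch F a₀ v → v = a₀ ∨ v = a₁)
    (hF : F ∈ tJoins G Set.univ S') : Rch F a₀ a₁ := by
  by_contra hn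
  rw [mem_tJoins_univ] at hF
  obtain ⟨hFG, hFodd⟩ := hF
  set K := clusterEdges F a₀ with hKdef
  have hdiag : ∀ e ∈ K, ¬ e.IsDiag := fun e he =>
    SimpleGraph.not_isDiag_of_mem_edgeSet G
      (SimpleGraph.mem_edgeFinset.1 (hFG (clusterEdges_subset F a₀ he)))
  have heven := even_card_odd_edeg hdiag
  have hO : (univ.filter fun v => Odd (edeg K v)) = {a₀} := by
    ext v
    simp only [mem_filter, mem_univ, true_and, mem_singleton]
    by_cases hv : Rch F a₀ v
    · rw [hKdef, odd_edeg_clusterEdges_iff hv, hFodd v]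
      constructor
      · intro hvS
        rcases hS' v hvS hv with h | h
        · exact h
        · exact absurd (h ▸ hv) hn
      · rintro rfl; exact ha₀
    · rw [hKdef, edeg_clusterEdges_eq_zero hv]
      constructor
      · intro h; exact absurd h Nat.not_odd_zero
      · rintro rfl; exact absurd (rch_refl F v) hv
  rw [hO, card_singleton] at heven
  exact Nat.not_even_one heven

/-- The `a₀`-cluster of a clean `T`-join lies in the cluster index set. -/
theorem clusterEdges_mem_clusterIndex {S' : Finset V} {a₀ a₁ a₂ a₃ : V}
    (ha₀ : a₀ ∈ S') (ha₁ : a₁ ∈ S') (hS' : ∀ v ∈ S', v ≠ a₀ → v ≠ a₁ → v = a₂ ∨ v = a₃)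
    {F : Finset (Sym2 V)} (hF : F ∈ tJoins G Set.univ S') (h2 : ¬ Rch F a₀ a₂)
    (h3 : ¬ Rch F a₀ a₃) : clusterEdges F a₀ ∈ clusterIndex G a₀ a₁ a₂ a₃ := by
  have hreach : ∀ v ∈ S', Rch F a₀ v → v = a₀ ∨ v = a₁ := by
    intro v hv hr
    by_cases h0 : v = a₀
    · exact Or.inl h0
    by_cases h1 : v = a₁
    · exact Or.inr h1
    rcases hS' v hv h0 h1 with rfl | rfl
    · exact absurd hr h2
    · exact absurd hr h3
  have h1 : Rch F a₀ a₁ := rch_a1 G ha₀ hreach hF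
  have hF' := hF
  rw [mem_tJoins_univ] at hF'
  obtain ⟨hFG, hFodd⟩ := hF'
  rw [mem_clusterIndex]
  refine ⟨(clusterEdges_subset F a₀).trans hFG, clusterEdges_idem F a₀, fun v => ?_, ?_, ?_⟩
  · by_cases hv : Rch F a₀ v
    · rw [odd_edeg_clusterEdges_iff hv, hFodd v, mem_insert, mem_singleton]
      exact ⟨fun hvS => hreach v hvS hv, fun h => h.elim (fun h => h ▸ ha₀) (fun h => h ▸ ha₁)⟩
    · rw [edeg_clusterEdges_eq_zero hv, mem_insert, mem_singleton]
      constructor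
      · intro h; exact absurd h Nat.not_odd_zero
      · rintro (rfl | rfl)
        · exact absurd (rch_refl F v) hv
        · exact absurd h1 hv
  · rwa [rch_clusterEdges_iff]
  · rwa [rch_clusterEdges_iff]

/-- **Outer decomposition**: a clean sum over `T`-joins is a sum over the cluster index set of
fibre sums. -/
theorem sum_clean_eq_sum_fibres {S' : Finset V} {a₀ a₁ a₂ a₃ : V}
    (ha₀ : a₀ ∈ S') (ha₁ : a₁ ∈ S') (hS' : ∀ v ∈ S', v ≠ a₀ → v ≠ a₁ → v = a₂ ∨ v = a₃)
    (g : Finset (Sym2 V) → ℝ) :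
    ∑ F ∈ (tJoins G Set.univ S').filter (fun F => ¬ Rch F a₀ a₂ ∧ ¬ Rch F a₀ a₃), g F =
      ∑ K ∈ clusterIndex G a₀ a₁ a₂ a₃,
        ∑ F ∈ (tJoins G Set.univ S').filter (fun F => clusterEdges F a₀ = K), g F := by
  have hmaps : ∀ F ∈ (tJoins G Set.univ S').filter (fun F => ¬ Rch F a₀ a₂ ∧ ¬ Rch F a₀ a₃),
      clusterEdges F a₀ ∈ clusterIndex G a₀ a₁ a₂ a₃ := by
    intro F hF
    rw [mem_filter] at hF
    exact clusterEdges_mem_clusterIndex G ha₀ ha₁ hS' hF.1 hF.2.1 hF.2.2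
  rw [← Finset.sum_fiberwise_of_maps_to hmaps g]
  refine Finset.sum_congr rfl fun K hK => ?_
  apply Finset.sum_congr ?_ (fun _ _ => rfl)
  obtain ⟨-, -, -, hK2, hK3⟩ := (mem_clusterIndex G).1 hK
  ext F
  simp only [mem_filter]
  constructor
  · rintro ⟨⟨hF, -⟩, hcl⟩; exact ⟨hF, hcl⟩
  · rintro ⟨hF, hcl⟩
    refine ⟨⟨hF, ?_, ?_⟩, hcl⟩
    · rw [← rch_clusterEdges_iff, hcl]; exact hK2
    · rw [← rch_clusterEdges_iff, hcl]; exact hK3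

/-- **Fibre evaluation, pair side**: over the fibre of `K`, `Σ t^|F| ⟨σ₂σ₃⟩_{depl F} = t^|K| · g_Λ({a₂,a₃})`. -/
theorem fibre_pair_side {a₀ a₁ a₂ a₃ : V} {K : Finset (Sym2 V)}
    (hK : K ∈ clusterIndex G a₀ a₁ a₂ a₃) (β : ℝ) :
    ∑ F ∈ (tJoins G Set.univ {a₀, a₁}).filter (fun F => clusterEdges F a₀ = K),
        Real.tanh β ^ F.card * isingCorr G (dVol F a₀) β 0 .free {a₂, a₃} =
      Real.tanh β ^ K.card * hteSum G (dVol K a₀) (Real.tanh β) {a₂, a₃} := by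
  obtain ⟨hKG, hKself, hKodd, hK2, hK3⟩ := (mem_clusterIndex G).1 hK
  have hfib := fibre_sum G hKG hKself hKodd (T := ∅) (empty_subset _)
    (fun F => Real.tanh β ^ F.card * isingCorr G (dVol F a₀) β 0 .free {a₂, a₃})
  rw [union_empty] at hfib
  rw [hfib]
  set Λ := dVol K a₀ with hΛ
  have hA : ({a₂, a₃} : Finset V) ⊆ Λ := by
    intro v hv
    rw [mem_insert, mem_singleton] at hv
    rcases hv with rfl | rfl
    · exact mem_dVol.2 hK2
    · exact mem_dVol.2 hK3
  have hne : hteSum G Λ (Real.tanh β) ∅ ≠ 0 := (hteSum_empty_pos G Λ β).ne'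
  have hsummand : ∀ R ∈ (edgesIn G Λ).powerset.filter (fun R => oddVerts Λ R = ∅),
      Real.tanh β ^ (K ∪ R).card * isingCorr G (dVol (K ∪ R) a₀) β 0 .free {a₂, a₃} =
        Real.tanh β ^ K.card * (hteSum G Λ (Real.tanh β) {a₂, a₃} / hteSum G Λ (Real.tanh β) ∅) *
          Real.tanh β ^ R.card := by
    intro R hR
    rw [mem_filter, mem_powerset] at hR
    have havoid : ∀ e ∈ R, ∀ v ∈ e, ¬ Rch K a₀ v := fun e he v hv =>
      mem_dVol.1 ((mem_edgesIn_iff.1 (hR.1 he)).2 v hv)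
    rw [dVol_union_eq havoid, card_union_of_disjoint (disjoint_of_avoid hKself havoid), pow_add,
      ← hΛ, isingCorr_free_eq_hteSum_div G Λ β hA]
    ring
  rw [Finset.sum_congr rfl hsummand, ← Finset.mul_sum]
  have hZ : ∑ R ∈ (edgesIn G Λ).powerset.filter (fun R => oddVerts Λ R = ∅), Real.tanh β ^ R.card =
      hteSum G Λ (Real.tanh β) ∅ := rfl
  rw [hZ]
  field_simp

/-- **Fibre evaluation, four-source side**: `Σ t^|F| = t^|K| · g_Λ({a₂,a₃})`. -/
theorem fibre_four_side {a₀ a₁ a₂ a₃ : V} {K : Finset (Sym2 V)}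
    (hK : K ∈ clusterIndex G a₀ a₁ a₂ a₃) (t : ℝ) :
    ∑ F ∈ (tJoins G Set.univ ({a₀, a₁} ∪ {a₂, a₃})).filter (fun F => clusterEdges F a₀ = K),
        t ^ F.card = t ^ K.card * hteSum G (dVol K a₀) t {a₂, a₃} := by
  obtain ⟨hKG, hKself, hKodd, hK2, hK3⟩ := (mem_clusterIndex G).1 hK
  have hT : ({a₂, a₃} : Finset V) ⊆ dVol K a₀ := by
    intro v hv
    rw [mem_insert, mem_singleton] at hv
    rcases hv with rfl | rfl
    · exact mem_dVol.2 hK2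
    · exact mem_dVol.2 hK3
  rw [fibre_sum G hKG hKself hKodd hT (fun F => t ^ F.card)]
  have hsummand : ∀ R ∈ (edgesIn G (dVol K a₀)).powerset.filter (fun R => oddVerts (dVol K a₀) R = {a₂, a₃}),
      t ^ (K ∪ R).card = t ^ K.card * t ^ R.card := by
    intro R hR
    rw [mem_filter, mem_powerset] at hR
    have havoid : ∀ e ∈ R, ∀ v ∈ e, ¬ Rch K a₀ v := fun e he v hv =>
      mem_dVol.1 ((mem_edgesIn_iff.1 (hR.1 he)).2 v hv)
    rw [card_union_of_disjoint (disjoint_of_avoid hKself havoid), pow_add]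
  rw [Finset.sum_congr rfl hsummand, ← Finset.mul_sum]
  rfl

/-- **(★), abstract form.** -/
theorem pairSplit_identity (a₀ a₁ a₂ a₃ : V) (β : ℝ) :
    ∑ F ∈ (tJoins G Set.univ {a₀, a₁}).filter (fun F => ¬ Rch F a₀ a₂ ∧ ¬ Rch F a₀ a₃),
        Real.tanh β ^ F.card * isingCorr G (dVol F a₀) β 0 .free {a₂, a₃} =
      ∑ F ∈ (tJoins G Set.univ ({a₀, a₁} ∪ {a₂, a₃})).filter (fun F => ¬ Rch F a₀ a₂ ∧ ¬ Rch F a₀ a₃),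
        Real.tanh β ^ F.card := by
  have hS₁ : ∀ v ∈ ({a₀, a₁} : Finset V), v ≠ a₀ → v ≠ a₁ → v = a₂ ∨ v = a₃ := by
    intro v hv h0 h1
    rw [mem_insert, mem_singleton] at hv
    rcases hv with rfl | rfl
    · exact absurd rfl h0
    · exact absurd rfl h1
  have hS₂ : ∀ v ∈ ({a₀, a₁} ∪ {a₂, a₃} : Finset V), v ≠ a₀ → v ≠ a₁ → v = a₂ ∨ v = a₃ := by
    intro v hv h0 h1
    rw [mem_union, mem_insert, mem_singleton, mem_insert, mem_singleton] at hv
    rcases hv with (rfl | rfl) | h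
    · exact absurd rfl h0
    · exact absurd rfl h1
    · exact h
  rw [sum_clean_eq_sum_fibres G (by simp) (by simp) hS₁,
    sum_clean_eq_sum_fibres G (by simp) (by simp) hS₂]
  refine Finset.sum_congr rfl fun K hK => ?_
  rw [fibre_pair_side G hK, fibre_four_side G hK]

end Assembly

/-! ### §4b LoopO1 ↔ HT-expansion bridges -/

section Bridge

variable {V : Type*} [Fintype V] [DecidableEq V] (G : SimpleGraph V) [DecidableRel G.Adj]

/-- `T`-joins of the whole graph = the index set of the high-temperature sum `g_univ(A)`:
LoopO1 vocabulary (`tJoins`) meets HT-expansion vocabulary (`edgesIn`, `oddVerts`). [folklore] -/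
theorem tJoins_univ_eq_filter (A : Finset V) :
    tJoins G Set.univ A = (edgesIn G Finset.univ).powerset.filter (fun F => oddVerts Finset.univ F = A) := by
  ext F
  rw [mem_tJoins, mem_filter, mem_powerset]
  simp only [Set.subset_univ, true_and]
  constructor
  · rintro ⟨hFG, hodd⟩
    refine ⟨fun e he => ?_, ?_⟩
    · rw [mem_edgesIn_iff]
      exact ⟨SimpleGraph.mem_edgeFinset.1 (hFG he), fun x _ => mem_univ x⟩
    · ext v
      rw [oddVerts, mem_filter]
      simp only [mem_univ, true_and]
      exact hodd v
  · rintro ⟨hFE, hodd⟩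
    refine ⟨fun e he => SimpleGraph.mem_edgeFinset.2 (mem_edgesIn_iff.1 (hFE he)).1, fun v => ?_⟩
    have := Finset.ext_iff.1 hodd v
    rw [oddVerts, mem_filter] at this
    simpa only [mem_univ, true_and] using this

/-- **`Z^A_t(G) = g_univ(A)`**: the sourced loop-O(1) partition function of `LoopO1.lean` is the
high-temperature generating sum of `ModifiedSimonInequality.lean` over the whole vertex set. [folklore] -/
theorem loopO1PartitionFunction_eq_hteSum (t : ℝ) (A : Finset V) :
    loopO1PartitionFunction G t A = hteSum G Finset.univ t A := by
  unfold loopO1PartitionFunction loopO1Weight hteSum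
  rw [← Finset.sum_filter]
  congr 1
  rw [← tJoins_univ_eq_filter]
  ext F
  simp only [mem_filter, mem_powerset, and_iff_right_iff_imp]
  intro hF
  exact ((mem_tJoins G).1 hF).1

/-- **High-temperature expansion in loop-O(1) dress**: `⟨σ_A⟩^free_{G;β,0} = Z^A_{tanh β}(G) / Z^∅_{tanh β}(G)`
for every `A` (the route's dictionary step "⟨σxσy⟩^free = Z^{xy}/Z⁰", for all source sets at once). [folklore] -/
theorem isingCorr_univ_free_eq_loopO1_div (β : ℝ) (A : Finset V) :
    isingCorr G Finset.univ β 0 .free A =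
      loopO1PartitionFunction G (Real.tanh β) A / loopO1PartitionFunction G (Real.tanh β) ∅ := by
  rw [loopO1PartitionFunction_eq_hteSum, loopO1PartitionFunction_eq_hteSum,
    isingCorr_free_eq_hteSum_div G Finset.univ β (Finset.subset_univ A)]

/-- `Z^∅_{tanh β}(G) > 0`. [folklore] -/
theorem loopO1PartitionFunction_empty_pos' (β : ℝ) :
    0 < loopO1PartitionFunction G (Real.tanh β) ∅ := by
  rw [loopO1PartitionFunction_eq_hteSum]; exact hteSum_empty_pos G _ β

end Bridge

/-! ### Transport of `T`-join sums and free correlations along a graph automorphism -/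

section Transport

variable {V : Type*} [Fintype V] [DecidableEq V] (G : SimpleGraph V) [DecidableRel G.Adj]

/-- The edge map of a vertex bijection. [folklore] -/
def emap (σ : V ≃ V) : Sym2 V ↪ Sym2 V :=
  ⟨Sym2.map σ, Sym2.map.injective σ.injective⟩

omit [Fintype V] [DecidableEq V] in
@[simp] theorem emap_apply (σ : V ≃ V) (e : Sym2 V) : emap σ e = Sym2.map σ e := rfl

omit [Fintype V] [DecidableEq V] in
theorem mem_emap_iff (σ : V ≃ V) (e : Sym2 V) (v : V) : σ v ∈ emap σ e ↔ v ∈ e := by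
  rw [emap_apply, Sym2.mem_map]
  constructor
  · rintro ⟨a, ha, hav⟩
    rwa [← σ.injective hav]
  · intro hv
    exact ⟨v, hv, rfl⟩

omit [Fintype V] [DecidableEq V] in
theorem emap_trans_symm (σ : V ≃ V) : (emap σ).trans (emap σ.symm) = Function.Embedding.refl _ := by
  ext e
  simp [Function.Embedding.trans, emap, Sym2.map_map, Function.comp_def]

omit [Fintype V] [DecidableEq V] in
theorem map_emap_map_symm (σ : V ≃ V) (F : Finset (Sym2 V)) :
    (F.map (emap σ)).map (emap σ.symm) = F := by
  rw [Finset.map_map, emap_trans_symm, Finset.map_refl]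

omit [Fintype V] [DecidableEq V] in
theorem map_emap_symm_map (σ : V ≃ V) (F : Finset (Sym2 V)) :
    (F.map (emap σ.symm)).map (emap σ) = F := by
  have := map_emap_map_symm σ.symm F
  rwa [Equiv.symm_symm] at this

omit [Fintype V] in
/-- Degrees are transported: `deg_{σF}(σ v) = deg_F(v)`. -/
theorem edeg_map_emap (σ : V ≃ V) (F : Finset (Sym2 V)) (v : V) :
    edeg (F.map (emap σ)) (σ v) = edeg F v := by
  unfold edeg
  rw [Finset.filter_map, Finset.card_map]
  congr 1
  ext e
  simp only [mem_filter, Function.comp_apply, and_congr_right_iff]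
  intro _
  exact mem_emap_iff σ e v

omit [DecidableEq V] in
/-- A graph automorphism maps `E(G)`-subsets to `E(G)`-subsets. -/
theorem map_emap_subset_edgeFinset {σ : V ≃ V} (hσ : ∀ u v, G.Adj (σ u) (σ v) ↔ G.Adj u v)
    {F : Finset (Sym2 V)} (hF : F ⊆ G.edgeFinset) : F.map (emap σ) ⊆ G.edgeFinset := by
  intro e he
  rw [Finset.mem_map] at he
  obtain ⟨e₀, he₀, rfl⟩ := he
  have h0 := hF he₀
  induction e₀ using Sym2.ind with
  | _ a b =>
    rw [SimpleGraph.mem_edgeFinset, SimpleGraph.mem_edgeSet] at h0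
    rw [emap_apply, Sym2.map_mk, SimpleGraph.mem_edgeFinset, SimpleGraph.mem_edgeSet]
    exact (hσ a b).2 h0

/-- `T`-joins are transported: `F ∈ 𝒯_A ⇒ σF ∈ 𝒯_{σA}`. -/
theorem map_emap_mem_tJoins {σ : V ≃ V} (hσ : ∀ u v, G.Adj (σ u) (σ v) ↔ G.Adj u v)
    {A : Finset V} {F : Finset (Sym2 V)} (hF : F ∈ tJoins G Set.univ A) :
    F.map (emap σ) ∈ tJoins G Set.univ (A.map σ.toEmbedding) := by
  rw [mem_tJoins_univ] at hF ⊢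
  refine ⟨map_emap_subset_edgeFinset G hσ hF.1, fun w => ?_⟩
  obtain ⟨v, rfl⟩ := σ.surjective w
  rw [edeg_map_emap, hF.2 v, Finset.mem_map_equiv, Equiv.symm_apply_apply]

omit [Fintype V] [DecidableEq V] [DecidableRel G.Adj] in
/-- The inverse of an automorphism is an automorphism. -/
theorem adj_symm_iff {σ : V ≃ V} (hσ : ∀ u v, G.Adj (σ u) (σ v) ↔ G.Adj u v) (u v : V) :
    G.Adj (σ.symm u) (σ.symm v) ↔ G.Adj u v := by
  have := hσ (σ.symm u) (σ.symm v)
  rwa [Equiv.apply_symm_apply, Equiv.apply_symm_apply, Iff.comm] at this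

omit [Fintype V] [DecidableEq V] in
/-- Reachability is transported forward along `σ`. -/
theorem rch_map_emap (σ : V ≃ V) (F : Finset (Sym2 V)) {a v : V} (h : Rch F a v) :
    Rch (F.map (emap σ)) (σ a) (σ v) := by
  let φ : (SimpleGraph.fromEdgeSet (↑F : Set (Sym2 V))) →g
      (SimpleGraph.fromEdgeSet (↑(F.map (emap σ)) : Set (Sym2 V))) :=
    { toFun := σ
      map_rel' := by
        intro u w huw
        rw [SimpleGraph.fromEdgeSet_adj] at huw ⊢
        refine ⟨?_, σ.injective.ne huw.2⟩
        rw [Finset.mem_coe, Finset.mem_map]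
        exact ⟨s(u, w), Finset.mem_coe.1 huw.1, by rw [emap_apply, Sym2.map_mk]⟩ }
  exact SimpleGraph.Reachable.map φ h

omit [Fintype V] [DecidableEq V] in
/-- Reachability is transported: `σa ↝_{σF} σv ↔ a ↝_F v`. -/
theorem rch_map_emap_iff (σ : V ≃ V) (F : Finset (Sym2 V)) (a v : V) :
    Rch (F.map (emap σ)) (σ a) (σ v) ↔ Rch F a v := by
  refine ⟨fun h => ?_, rch_map_emap σ F⟩
  have h' := rch_map_emap σ.symm (F.map (emap σ)) h
  rwa [map_emap_map_symm, Equiv.symm_apply_apply, Equiv.symm_apply_apply] at h'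

/-- **Transport of sums over `T`-joins along a graph automorphism.** -/
theorem sum_tJoins_transport {σ : V ≃ V} (hσ : ∀ u v, G.Adj (σ u) (σ v) ↔ G.Adj u v)
    (A : Finset V) (f g : Finset (Sym2 V) → ℝ)
    (hfg : ∀ F ∈ tJoins G Set.univ A, f F = g (F.map (emap σ))) :
    ∑ F ∈ tJoins G Set.univ A, f F = ∑ F ∈ tJoins G Set.univ (A.map σ.toEmbedding), g F := by
  refine Finset.sum_nbij' (fun F => F.map (emap σ)) (fun F => F.map (emap σ.symm)) ?_ ?_ ?_ ?_ hfg
  · intro F hF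
    exact map_emap_mem_tJoins G hσ hF
  · intro F hF
    have h := map_emap_mem_tJoins G (adj_symm_iff G hσ) hF
    have hA : (A.map σ.toEmbedding).map σ.symm.toEmbedding = A := by
      ext x
      simp only [Finset.mem_map_equiv, Equiv.symm_symm, Equiv.symm_apply_apply]
    rwa [hA] at h
  · intro F _
    exact map_emap_map_symm σ F
  · intro F _
    exact map_emap_symm_map σ F

end Transport

/-! ### Symmetry consequences: equal split sums, `3·Z_split ≤ Z_A`, equal pair correlations -/

section ThreeFold

variable {V : Type*} [Fintype V] [DecidableEq V] (G : SimpleGraph V) [DecidableRel G.Adj]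

/-- The clean four-source sum "the `x`-cluster avoids `y` and `z`". [folklore] -/
def Zsp (A : Finset V) (t : ℝ) (x y z : V) : ℝ :=
  ∑ F ∈ (tJoins G Set.univ A).filter (fun F => ¬ Rch F x y ∧ ¬ Rch F x z), t ^ F.card

theorem zsp_comm (A : Finset V) (t : ℝ) (x y z : V) : Zsp G A t x y z = Zsp G A t x z y := by
  unfold Zsp
  refine Finset.sum_congr ?_ (fun _ _ => rfl)
  ext F
  simp only [mem_filter, and_congr_right_iff]
  exact fun _ => And.comm

/-- (★) with the right-hand side folded as `Zsp` (syntactic bridge for the crux assembly). -/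
theorem pairSplit_identity_zsp (a₀ a₁ a₂ a₃ : V) (β : ℝ) :
    ∑ F ∈ (tJoins G Set.univ {a₀, a₁}).filter (fun F => ¬ Rch F a₀ a₂ ∧ ¬ Rch F a₀ a₃),
        Real.tanh β ^ F.card * isingCorr G (dVol F a₀) β 0 .free {a₂, a₃} =
      Zsp G ({a₀, a₁} ∪ {a₂, a₃}) (Real.tanh β) a₀ a₂ a₃ :=
  pairSplit_identity G a₀ a₁ a₂ a₃ β

/-- Split sums are transported along an automorphism fixing the terminal set. -/
theorem zsp_transport {σ : V ≃ V} (hσ : ∀ u v, G.Adj (σ u) (σ v) ↔ G.Adj u v) {A : Finset V}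
    (hA : A.map σ.toEmbedding = A) (t : ℝ) (x y z : V) :
    Zsp G A t x y z = Zsp G A t (σ x) (σ y) (σ z) := by
  unfold Zsp
  rw [Finset.sum_filter, Finset.sum_filter]
  have key := sum_tJoins_transport G hσ A
    (fun F => if ¬ Rch F x y ∧ ¬ Rch F x z then t ^ F.card else 0)
    (fun F => if ¬ Rch F (σ x) (σ y) ∧ ¬ Rch F (σ x) (σ z) then t ^ F.card else 0) ?_
  · rw [hA] at key
    exact key
  · intro F _
    simp only [rch_map_emap_iff, Finset.card_map]

/-- Free pair correlations are transported along an automorphism. -/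
theorem isingCorr_map_transport {σ : V ≃ V} (hσ : ∀ u v, G.Adj (σ u) (σ v) ↔ G.Adj u v)
    (β : ℝ) (B : Finset V) :
    isingCorr G Finset.univ β 0 .free (B.map σ.toEmbedding) = isingCorr G Finset.univ β 0 .free B := by
  rw [isingCorr_univ_free_eq_loopO1_div, isingCorr_univ_free_eq_loopO1_div,
    loopO1PartitionFunction_eq_sum_tJoins G _ (B.map σ.toEmbedding),
    loopO1PartitionFunction_eq_sum_tJoins G _ B]
  congr 1
  symm
  exact sum_tJoins_transport G hσ B (fun F => Real.tanh β ^ F.card) (fun F => Real.tanh β ^ F.card)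
    (fun F _ => by rw [Finset.card_map])

theorem isingCorr_pair_transport {σ : V ≃ V} (hσ : ∀ u v, G.Adj (σ u) (σ v) ↔ G.Adj u v)
    (β : ℝ) (x y : V) :
    isingCorr G Finset.univ β 0 .free {σ x, σ y} = isingCorr G Finset.univ β 0 .free {x, y} := by
  have : ({x, y} : Finset V).map σ.toEmbedding = {σ x, σ y} := by
    rw [Finset.map_insert, Finset.map_singleton]; rfl
  rw [← this, isingCorr_map_transport G hσ]

/-- **At most one split**: for `F ∈ 𝒯_A` (`A ⊇` the four terminals, the others unreachable is
impossible by the handshake), the three clean events are pairwise exclusive, so for `t ≥ 0`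
`Zsp(a₂,a₃) + Zsp(a₁,a₃) + Zsp(a₁,a₂) ≤ Z_A`. -/
theorem zsp_three_le {A : Finset V} {a₀ a₁ a₂ a₃ : V} (ha₀ : a₀ ∈ A)
    (hA : ∀ v ∈ A, v = a₀ ∨ v = a₁ ∨ v = a₂ ∨ v = a₃) {t : ℝ} (ht : 0 ≤ t) :
    Zsp G A t a₀ a₂ a₃ + Zsp G A t a₀ a₁ a₃ + Zsp G A t a₀ a₁ a₂ ≤
      ∑ F ∈ tJoins G Set.univ A, t ^ F.card := by
  unfold Zsp
  rw [Finset.sum_filter, Finset.sum_filter, Finset.sum_filter, ← Finset.sum_add_distrib,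
    ← Finset.sum_add_distrib]
  refine Finset.sum_le_sum fun F hF => ?_
  have hw : 0 ≤ t ^ F.card := pow_nonneg ht _
  -- if two terminals among a₁,a₂,a₃ are unreachable, the third is reachable
  have key : ∀ {p q r : V}, (∀ v ∈ A, v = a₀ ∨ v = p ∨ v = q ∨ v = r) →
      ¬ Rch F a₀ q → ¬ Rch F a₀ r → Rch F a₀ p := by
    intro p q r hApqr hq hr
    refine rch_a1 G ha₀ (fun v hv hreach => ?_) hF
    rcases hApqr v hv with h | h | h | h
    · exact Or.inl h
    · exact Or.inr h
    · exact absurd (h ▸ hreach) hq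
    · exact absurd (h ▸ hreach) hr
  have hA' : ∀ v ∈ A, v = a₀ ∨ v = a₂ ∨ v = a₁ ∨ v = a₃ := fun v hv => by
    rcases hA v hv with h | h | h | h <;> simp [h]
  have hA'' : ∀ v ∈ A, v = a₀ ∨ v = a₃ ∨ v = a₁ ∨ v = a₂ := fun v hv => by
    rcases hA v hv with h | h | h | h <;> simp [h]
  by_cases h23 : ¬ Rch F a₀ a₂ ∧ ¬ Rch F a₀ a₃
  · have h1 : Rch F a₀ a₁ := key hA h23.1 h23.2
    have h13 : ¬ (¬ Rch F a₀ a₁ ∧ ¬ Rch F a₀ a₃) := fun h => h.1 h1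
    have h12 : ¬ (¬ Rch F a₀ a₁ ∧ ¬ Rch F a₀ a₂) := fun h => h.1 h1
    rw [if_pos h23, if_neg h13, if_neg h12]; linarith
  · rw [if_neg h23]
    by_cases h13 : ¬ Rch F a₀ a₁ ∧ ¬ Rch F a₀ a₃
    · have h2 : Rch F a₀ a₂ := key hA' h13.1 h13.2
      have h12 : ¬ (¬ Rch F a₀ a₁ ∧ ¬ Rch F a₀ a₂) := fun h => h.2 h2
      rw [if_pos h13, if_neg h12]; linarith
    · rw [if_neg h13]
      by_cases h12 : ¬ Rch F a₀ a₁ ∧ ¬ Rch F a₀ a₂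
      · rw [if_pos h12]; linarith
      · rw [if_neg h12]; linarith

/-- **Costume core (finite graph).** Two automorphisms acting on the four terminals as the
transpositions `(a₁ a₂)` and `(a₁ a₃)` (both fixing `a₀`) force `3 · Zsp(a₂,a₃) ≤ Z_A` and
`G₀₁ = G₀₂ = G₀₃`, `G₂₃ = G₁₃ = G₁₂`. -/
theorem costume_core {σ₁ σ₂ : V ≃ V} (hσ₁ : ∀ u v, G.Adj (σ₁ u) (σ₁ v) ↔ G.Adj u v)
    (hσ₂ : ∀ u v, G.Adj (σ₂ u) (σ₂ v) ↔ G.Adj u v) {a₀ a₁ a₂ a₃ : V}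
    (h10 : σ₁ a₀ = a₀) (h11 : σ₁ a₁ = a₂) (h12 : σ₁ a₂ = a₁) (h13 : σ₁ a₃ = a₃)
    (h20 : σ₂ a₀ = a₀) (h21 : σ₂ a₁ = a₃) (h22 : σ₂ a₂ = a₂) (h23 : σ₂ a₃ = a₁)
    {t : ℝ} (ht : 0 ≤ t) :
    3 * Zsp G ({a₀, a₁} ∪ {a₂, a₃}) t a₀ a₂ a₃ ≤
      ∑ F ∈ tJoins G Set.univ ({a₀, a₁} ∪ {a₂, a₃}), t ^ F.card := by
  set A : Finset V := {a₀, a₁} ∪ {a₂, a₃} with hAdef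
  have hAmem : ∀ v ∈ A, v = a₀ ∨ v = a₁ ∨ v = a₂ ∨ v = a₃ := by
    intro v hv
    simp only [hAdef, mem_union, mem_insert, mem_singleton] at hv
    tauto
  have hA₁ : A.map σ₁.toEmbedding = A := by
    ext v
    simp only [hAdef, Finset.mem_map_equiv, mem_union, mem_insert, mem_singleton]
    constructor
    · rintro ((h | h) | (h | h))
      · have := congrArg σ₁ h; rw [Equiv.apply_symm_apply, h10] at this; simp [this]
      · have := congrArg σ₁ h; rw [Equiv.apply_symm_apply, h11] at this; simp [this]
      · have := congrArg σ₁ h; rw [Equiv.apply_symm_apply, h12] at this; simp [this]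
      · have := congrArg σ₁ h; rw [Equiv.apply_symm_apply, h13] at this; simp [this]
    · rintro ((rfl | rfl) | (rfl | rfl))
      · left; left; exact σ₁.symm_apply_eq.2 h10.symm
      · right; left; exact σ₁.symm_apply_eq.2 h12.symm
      · left; right; exact σ₁.symm_apply_eq.2 h11.symm
      · right; right; exact σ₁.symm_apply_eq.2 h13.symm
  have hA₂ : A.map σ₂.toEmbedding = A := by
    ext v
    simp only [hAdef, Finset.mem_map_equiv, mem_union, mem_insert, mem_singleton]
    constructor
    · rintro ((h | h) | (h | h))
      · have := congrArg σ₂ h; rw [Equiv.apply_symm_apply, h20] at this; simp [this]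
      · have := congrArg σ₂ h; rw [Equiv.apply_symm_apply, h21] at this; simp [this]
      · have := congrArg σ₂ h; rw [Equiv.apply_symm_apply, h22] at this; simp [this]
      · have := congrArg σ₂ h; rw [Equiv.apply_symm_apply, h23] at this; simp [this]
    · rintro ((rfl | rfl) | (rfl | rfl))
      · left; left; exact σ₂.symm_apply_eq.2 h20.symm
      · right; right; exact σ₂.symm_apply_eq.2 h23.symm
      · right; left; exact σ₂.symm_apply_eq.2 h22.symm
      · left; right; exact σ₂.symm_apply_eq.2 h21.symm
  have e1 : Zsp G A t a₀ a₂ a₃ = Zsp G A t a₀ a₁ a₃ := by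
    rw [zsp_transport G hσ₁ hA₁ t a₀ a₂ a₃, h10, h12, h13]
  have e2 : Zsp G A t a₀ a₂ a₃ = Zsp G A t a₀ a₁ a₂ := by
    rw [zsp_transport G hσ₂ hA₂ t a₀ a₂ a₃, h20, h22, h23, zsp_comm]
  have h3 := zsp_three_le G (A := A) (by simp [hAdef]) hAmem ht
  linarith

/-- (★) with the `Finset.filter` instances PINNED to the shape the crux body elaborates to in the
Theses file (outer: `Classical.propDecidable`, inner: `instDecidableNot ∘ Classical.propDecidable`),
so that it applies to the `StrandShadow` / `StrandShadowClean` bodies by `exact`/`rw` (no instance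
transport).  If a restated body elaborates differently, fall back on `convert pairSplit_identity`. -/
theorem pairSplit_identity_pinned (a₀ a₁ a₂ a₃ : V) (β : ℝ) :
    ∑ F ∈ @Finset.filter _ (fun F => ¬ Rch F a₀ a₂ ∧ ¬ Rch F a₀ a₃)
        (fun _ => Classical.propDecidable _) (tJoins G Set.univ {a₀, a₁}),
        Real.tanh β ^ F.card * isingCorr G (@Finset.filter _ (fun v => ¬ Rch F a₀ v)
          (fun _ => @instDecidableNot _ (Classical.propDecidable _)) Finset.univ) β 0 .free {a₂, a₃} =
      ∑ F ∈ @Finset.filter _ (fun F => ¬ Rch F a₀ a₂ ∧ ¬ Rch F a₀ a₃)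
        (fun _ => Classical.propDecidable _) (tJoins G Set.univ ({a₀, a₁} ∪ {a₂, a₃})),
        Real.tanh β ^ F.card := by
  convert pairSplit_identity G a₀ a₁ a₂ a₃ β using 4
  ext v
  simp [dVol, Finset.mem_filter]

end ThreeFold

/-! ### §4c The crux frame: costume statements -/

section Costume

variable {V : Type*} [Fintype V] [DecidableEq V] (G : SimpleGraph V) [DecidableRel G.Adj]

/-- **(★) Pair-split deletion identity** (finite graph, any real `t`, zero field, `β` with
`tanh β = t` on the Ising side): summing the depleted pair correlation against the sourced loop
weights of ONE pair reproduces the four-source loop sum restricted to the split `01|23`: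
`Σ_{F₁ ∈ 𝒯₀₁(G), a₂,a₃ ∉ V(K_{a₀}F₁)} t^|F₁| · ⟨σ_{a₂}σ_{a₃}⟩^free_{G, V ∖ V(K_{a₀}F₁)}
   = Σ_{F ∈ 𝒯_{0123}(G), a₂,a₃ ∉ V(K_{a₀}F)} t^|F|`.
Proof sketch: `F₁ ↦ (K, R) = (edges of the a₀-component, the rest)` is a bijection onto
{connected `K ∋ a₀` with `∂K = {a₀,a₁}`, `V(K) ∌ a₂,a₃`} × {even subgraphs of `G[V ∖ V(K)]`}, so the
left side is `Σ_K t^|K| Z⁰(G[V∖V(K)]) · Z^{23}(G[V∖V(K)])/Z⁰(G[V∖V(K)]) = Σ_K t^|K| Z^{23}(G[V∖V(K)])`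
(HT expansion `isingCorr_free_eq_hteSum_div` on the induced subgraph), and `(K, R') ↦ K ∪ R'`
with `R' ∈ 𝒯₂₃(G[V∖V(K)])` is a bijection onto the right-hand index set.  Verified exhaustively on
K4, Q3, Q3+diag, 3×3+chord (rattack seat, shadow_exact.py) and on `Λ_N ⊂ ℤ³` by MC within errors
(j013016: T-join-side `s_clean` = spin-side `s_sym`).  Dimension-free; **PROVED below**
(`pairSplitDeletionIdentity_holds`, from `pairSplit_identity`, §4a; axioms standard).  NOTE for users
at the crux: the crux body's `Finset.filter` instances are classical (elaboration accident of the
Theses file) while these generic lemmas carry constructive ones — transport with `convert` (see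
`int_imp_strandShadowClean`), never `exact`/`rw` (the defeq check then unfolds `Finset.univ` of the box
and times out). -/
def PairSplitDeletionIdentity : Prop :=
  ∀ (V : Type) [Fintype V] [DecidableEq V] (G : SimpleGraph V) [DecidableRel G.Adj] (β : ℝ),
    0 ≤ β → ∀ a : Fin 4 → V, Function.Injective a →
    (let t : ℝ := Real.tanh β
     let R : Finset (Sym2 V) → V → Prop := fun F v =>
       (SimpleGraph.fromEdgeSet (↑F : Set (Sym2 V))).Reachable (a 0) v
     (∑ F ∈ (tJoins G Set.univ {a 0, a 1}).filter (fun F => ¬ R F (a 2) ∧ ¬ R F (a 3)),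
        t ^ F.card * isingCorr G (Finset.univ.filter fun v => ¬ R F v) β 0 .free {a 2, a 3})
      = ∑ F ∈ (tJoins G Set.univ (Finset.univ.image a)).filter (fun F => ¬ R F (a 2) ∧ ¬ R F (a 3)),
          t ^ F.card)

/-- **(★) holds** (kernel-checked; the `0 ≤ β` and injectivity hypotheses are not even needed). -/
theorem pairSplitDeletionIdentity_holds : PairSplitDeletionIdentity := by
  intro V _ _ G _ β _ a _
  have himg : (Finset.univ.image a : Finset V) = {a 0, a 1} ∪ {a 2, a 3} := by
    ext v
    simp only [Finset.mem_image, Finset.mem_univ, true_and, Finset.mem_union, Finset.mem_insert,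
      Finset.mem_singleton]
    constructor
    · rintro ⟨i, rfl⟩
      fin_cases i <;> simp
    · rintro ((rfl | rfl) | (rfl | rfl)) <;> exact ⟨_, rfl⟩
  simp only [himg]
  exact pairSplit_identity G (a 0) (a 1) (a 2) (a 3) β

/-- **Costume corollary (documented target for a support prover).** With (★), the HT expansions
`Z^A/Z⁰ = ⟨σ_A⟩`, `Z^{ij}/Z⁰ = ⟨σᵢσⱼ⟩` and the `S₄` symmetry of `(Λ_N, l·tetra)` (coordinate
permutations fix `a₀` and permute `a₁,a₂,a₃` transitively; `(x,y,z) ↦ (-x,-y,z)` swaps the pairs),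
the clean shadow ratio is `s_clean = ⟨σ_A⟩(1 - P_C)/(3 G₀₁ G₂₃) = (1 - (2/3)·Int)(1 - P_C)` with
`Int := -U₄/(2 G₀₁G₂₃)`, whence `INT → StrandShadowClean` with `c = (2/3)c₀`, and conversely (via
`DepletionBound`) `StrandShadowClean → (1 - Int ≤ 1 - c)`.  `INT` below is the lattice clause
(iii) at the tetrahedron, i.e. the conclusion `IndependentStrandsJoin ∧ StrandsJoinBound` feed
into `LatticeBoundFromStrands`. -/
def INT : Prop :=
  let tetra : Fin 4 → Site 3 := ![![-1, -1, -1], ![1, 1, -1], ![1, -1, 1], ![-1, 1, 1]]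
  ∃ c : ℝ, 0 < c ∧ ∀ l : ℕ, 1 ≤ l → ∃ N₀ : ℕ, ∀ N : ℕ, N₀ ≤ N → ∀ a : Fin 4 → ↥(box 3 N),
    (∀ i, ((a i : Site 3)) = (l : ℤ) • tetra i) →
    (let G := (zdGraph 3).comap (Subtype.val : ↥(box 3 N) → Site 3)
     let β : ℝ := criticalBeta 3
     let Gc : Fin 4 → Fin 4 → ℝ := fun i j => isingCorr G Finset.univ β 0 .free {a i, a j}
     2 * c * (Gc 0 1 * Gc 2 3) ≤
       Gc 0 1 * Gc 2 3 + Gc 0 2 * Gc 1 3 + Gc 0 3 * Gc 1 2 - isingCorr G Finset.univ β 0 .free (Finset.univ.image a))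

end Costume


/-! ### §4d The tetrahedral symmetry of the box and `INT → StrandShadowClean` -/

section Box

/-- Coordinate permutation of the box `{-N..N}³`, as a bijection of its vertex type. [folklore] -/
def boxPerm (N : ℕ) (π : Equiv.Perm (Fin 3)) : ↥(box 3 N) ≃ ↥(box 3 N) where
  toFun x := ⟨fun i => (x : Site 3) (π i), by
    have hx := x.2
    rw [mem_box] at hx ⊢
    exact fun i => hx (π i)⟩
  invFun x := ⟨fun i => (x : Site 3) (π.symm i), by
    have hx := x.2
    rw [mem_box] at hx ⊢
    exact fun i => hx (π.symm i)⟩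
  left_inv x := by ext i; simp
  right_inv x := by ext i; simp

theorem boxPerm_apply_coe (N : ℕ) (π : Equiv.Perm (Fin 3)) (x : ↥(box 3 N)) :
    ((boxPerm N π x : ↥(box 3 N)) : Site 3) = fun i => (x : Site 3) (π i) := rfl

/-- Precomposition with a coordinate permutation is an order automorphism of `Site 3`. [folklore] -/
def sitePermIso (π : Equiv.Perm (Fin 3)) : Site 3 ≃o Site 3 where
  toFun x := fun i => x (π i)
  invFun x := fun i => x (π.symm i)
  left_inv x := by funext i; simp
  right_inv x := by funext i; simp
  map_rel_iff' := by
    intro x y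
    simp only [Equiv.coe_fn_mk, Pi.le_def]
    exact ⟨fun h i => by simpa using h (π.symm i), fun h i => h (π i)⟩

/-- Coordinate permutations are automorphisms of the nearest-neighbour box graph. -/
theorem boxPerm_adj_iff (N : ℕ) (π : Equiv.Perm (Fin 3)) (u v : ↥(box 3 N)) :
    ((zdGraph 3).comap (Subtype.val : ↥(box 3 N) → Site 3)).Adj (boxPerm N π u) (boxPerm N π v) ↔
      ((zdGraph 3).comap (Subtype.val : ↥(box 3 N) → Site 3)).Adj u v := by
  rw [SimpleGraph.comap_adj, SimpleGraph.comap_adj, boxPerm_apply_coe, boxPerm_apply_coe]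
  change (SimpleGraph.hasse (Site 3)).Adj (sitePermIso π u) (sitePermIso π v) ↔
    (SimpleGraph.hasse (Site 3)).Adj u v
  rw [SimpleGraph.hasse_adj, SimpleGraph.hasse_adj, apply_covBy_apply_iff, apply_covBy_apply_iff]

/-- How a coordinate permutation moves the dilated tetrahedron: if row `k` of the pattern, read
through `π`, is row `k'`, then `boxPerm π (a k) = a k'`. -/
theorem boxPerm_tetra {N : ℕ} {π : Equiv.Perm (Fin 3)} {l : ℕ} {a : Fin 4 → ↥(box 3 N)}
    (ha : ∀ i, ((a i : Site 3)) = (l : ℤ) •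
      (![![-1, -1, -1], ![1, 1, -1], ![1, -1, 1], ![-1, 1, 1]] : Fin 4 → Site 3) i)
    {k k' : Fin 4}
    (hkk : ∀ i : Fin 3, (![![-1, -1, -1], ![1, 1, -1], ![1, -1, 1], ![-1, 1, 1]] : Fin 4 → Site 3) k (π i)
      = (![![-1, -1, -1], ![1, 1, -1], ![1, -1, 1], ![-1, 1, 1]] : Fin 4 → Site 3) k' i) :
    boxPerm N π (a k) = a k' := by
  apply Subtype.ext
  rw [boxPerm_apply_coe, ha k, ha k']
  funext i
  simp only [Pi.smul_apply, hkk i]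

/-- The two transpositions of the route's frame: `(y z)` swaps `a₁ ↔ a₂`, `(x z)` swaps `a₁ ↔ a₃`. -/
theorem tetra_swap_facts :
    (∀ i : Fin 3, (![![-1, -1, -1], ![1, 1, -1], ![1, -1, 1], ![-1, 1, 1]] : Fin 4 → Site 3) 0 (Equiv.swap (1 : Fin 3) 2 i)
      = (![![-1, -1, -1], ![1, 1, -1], ![1, -1, 1], ![-1, 1, 1]] : Fin 4 → Site 3) 0 i) ∧
    (∀ i : Fin 3, (![![-1, -1, -1], ![1, 1, -1], ![1, -1, 1], ![-1, 1, 1]] : Fin 4 → Site 3) 1 (Equiv.swap (1 : Fin 3) 2 i)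
      = (![![-1, -1, -1], ![1, 1, -1], ![1, -1, 1], ![-1, 1, 1]] : Fin 4 → Site 3) 2 i) ∧
    (∀ i : Fin 3, (![![-1, -1, -1], ![1, 1, -1], ![1, -1, 1], ![-1, 1, 1]] : Fin 4 → Site 3) 2 (Equiv.swap (1 : Fin 3) 2 i)
      = (![![-1, -1, -1], ![1, 1, -1], ![1, -1, 1], ![-1, 1, 1]] : Fin 4 → Site 3) 1 i) ∧
    (∀ i : Fin 3, (![![-1, -1, -1], ![1, 1, -1], ![1, -1, 1], ![-1, 1, 1]] : Fin 4 → Site 3) 3 (Equiv.swap (1 : Fin 3) 2 i)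
      = (![![-1, -1, -1], ![1, 1, -1], ![1, -1, 1], ![-1, 1, 1]] : Fin 4 → Site 3) 3 i) ∧
    (∀ i : Fin 3, (![![-1, -1, -1], ![1, 1, -1], ![1, -1, 1], ![-1, 1, 1]] : Fin 4 → Site 3) 0 (Equiv.swap (0 : Fin 3) 2 i)
      = (![![-1, -1, -1], ![1, 1, -1], ![1, -1, 1], ![-1, 1, 1]] : Fin 4 → Site 3) 0 i) ∧
    (∀ i : Fin 3, (![![-1, -1, -1], ![1, 1, -1], ![1, -1, 1], ![-1, 1, 1]] : Fin 4 → Site 3) 1 (Equiv.swap (0 : Fin 3) 2 i)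
      = (![![-1, -1, -1], ![1, 1, -1], ![1, -1, 1], ![-1, 1, 1]] : Fin 4 → Site 3) 3 i) ∧
    (∀ i : Fin 3, (![![-1, -1, -1], ![1, 1, -1], ![1, -1, 1], ![-1, 1, 1]] : Fin 4 → Site 3) 2 (Equiv.swap (0 : Fin 3) 2 i)
      = (![![-1, -1, -1], ![1, 1, -1], ![1, -1, 1], ![-1, 1, 1]] : Fin 4 → Site 3) 2 i) ∧
    (∀ i : Fin 3, (![![-1, -1, -1], ![1, 1, -1], ![1, -1, 1], ![-1, 1, 1]] : Fin 4 → Site 3) 3 (Equiv.swap (0 : Fin 3) 2 i)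
      = (![![-1, -1, -1], ![1, 1, -1], ![1, -1, 1], ![-1, 1, 1]] : Fin 4 → Site 3) 1 i) := by
  decide


/-- The two coordinate transpositions act on the dilated tetrahedron as `(a₁ a₂)` (swap of the
`y,z` coordinates) and `(a₁ a₃)` (swap of `x,z`), both fixing `a₀`. -/
theorem boxPerm_swaps {N l : ℕ} {a : Fin 4 → ↥(box 3 N)}
    (ha : ∀ i, ((a i : Site 3)) = (l : ℤ) • (![![-1, -1, -1], ![1, 1, -1], ![1, -1, 1], ![-1, 1, 1]] : Fin 4 → Site 3) i) :
    (boxPerm N (Equiv.swap (1 : Fin 3) 2) (a 0) = a 0 ∧ boxPerm N (Equiv.swap (1 : Fin 3) 2) (a 1) = a 2 ∧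
      boxPerm N (Equiv.swap (1 : Fin 3) 2) (a 2) = a 1 ∧ boxPerm N (Equiv.swap (1 : Fin 3) 2) (a 3) = a 3) ∧
    (boxPerm N (Equiv.swap (0 : Fin 3) 2) (a 0) = a 0 ∧ boxPerm N (Equiv.swap (0 : Fin 3) 2) (a 1) = a 3 ∧
      boxPerm N (Equiv.swap (0 : Fin 3) 2) (a 2) = a 2 ∧ boxPerm N (Equiv.swap (0 : Fin 3) 2) (a 3) = a 1) := by
  obtain ⟨f10, f11, f12, f13, f20, f21, f22, f23⟩ := tetra_swap_facts
  exact ⟨⟨boxPerm_tetra ha f10, boxPerm_tetra ha f11, boxPerm_tetra ha f12, boxPerm_tetra ha f13⟩,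
    ⟨boxPerm_tetra ha f20, boxPerm_tetra ha f21, boxPerm_tetra ha f22, boxPerm_tetra ha f23⟩⟩

/-- **Tetrahedral symmetry of the free pair correlations in the box**:
`G₀₂ = G₀₁`, `G₁₃ = G₂₃`, `G₀₃ = G₀₁`, `G₁₂ = G₂₃` (any `β`). -/
theorem box_pairCorr_symm {N l : ℕ} {a : Fin 4 → ↥(box 3 N)}
    (ha : ∀ i, ((a i : Site 3)) = (l : ℤ) • (![![-1, -1, -1], ![1, 1, -1], ![1, -1, 1], ![-1, 1, 1]] : Fin 4 → Site 3) i) (β : ℝ) :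
    isingCorr ((zdGraph 3).comap (Subtype.val : ↥(box 3 N) → Site 3)) Finset.univ β 0 .free {a 0, a 2} = isingCorr ((zdGraph 3).comap (Subtype.val : ↥(box 3 N) → Site 3)) Finset.univ β 0 .free {a 0, a 1} ∧
    isingCorr ((zdGraph 3).comap (Subtype.val : ↥(box 3 N) → Site 3)) Finset.univ β 0 .free {a 1, a 3} = isingCorr ((zdGraph 3).comap (Subtype.val : ↥(box 3 N) → Site 3)) Finset.univ β 0 .free {a 2, a 3} ∧
    isingCorr ((zdGraph 3).comap (Subtype.val : ↥(box 3 N) → Site 3)) Finset.univ β 0 .free {a 0, a 3} = isingCorr ((zdGraph 3).comap (Subtype.val : ↥(box 3 N) → Site 3)) Finset.univ β 0 .free {a 0, a 1} ∧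
    isingCorr ((zdGraph 3).comap (Subtype.val : ↥(box 3 N) → Site 3)) Finset.univ β 0 .free {a 1, a 2} = isingCorr ((zdGraph 3).comap (Subtype.val : ↥(box 3 N) → Site 3)) Finset.univ β 0 .free {a 2, a 3} := by
  obtain ⟨⟨h10, h11, h12, h13⟩, ⟨h20, h21, h22, h23⟩⟩ := boxPerm_swaps ha
  have hσ₁ := boxPerm_adj_iff N (Equiv.swap (1 : Fin 3) 2)
  have hσ₂ := boxPerm_adj_iff N (Equiv.swap (0 : Fin 3) 2)
  refine ⟨?_, ?_, ?_, ?_⟩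
  · have := isingCorr_pair_transport ((zdGraph 3).comap (Subtype.val : ↥(box 3 N) → Site 3)) hσ₁ β (a 0) (a 1)
    rwa [h10, h11] at this
  · have := isingCorr_pair_transport ((zdGraph 3).comap (Subtype.val : ↥(box 3 N) → Site 3)) hσ₁ β (a 2) (a 3)
    rwa [h12, h13] at this
  · have := isingCorr_pair_transport ((zdGraph 3).comap (Subtype.val : ↥(box 3 N) → Site 3)) hσ₂ β (a 0) (a 1)
    rwa [h20, h21] at this
  · have := isingCorr_pair_transport ((zdGraph 3).comap (Subtype.val : ↥(box 3 N) → Site 3)) hσ₂ β (a 2) (a 3)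
    rw [h22, h23, Finset.pair_comm] at this
    exact this

/-- **Three clean pairings in the box**: `3 · Zsp(a₂,a₃) ≤ Z_A` (`t ≥ 0`; the three split sums are
equal by symmetry and pairwise exclusive by the handshake). -/
theorem box_three_zsp_le {N l : ℕ} {a : Fin 4 → ↥(box 3 N)}
    (ha : ∀ i, ((a i : Site 3)) = (l : ℤ) • (![![-1, -1, -1], ![1, 1, -1], ![1, -1, 1], ![-1, 1, 1]] : Fin 4 → Site 3) i) {t : ℝ} (ht : 0 ≤ t) :
    3 * Zsp ((zdGraph 3).comap (Subtype.val : ↥(box 3 N) → Site 3)) ({a 0, a 1} ∪ {a 2, a 3}) t (a 0) (a 2) (a 3) ≤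
      ∑ F ∈ tJoins ((zdGraph 3).comap (Subtype.val : ↥(box 3 N) → Site 3)) Set.univ ({a 0, a 1} ∪ {a 2, a 3}), t ^ F.card := by
  obtain ⟨⟨h10, h11, h12, h13⟩, ⟨h20, h21, h22, h23⟩⟩ := boxPerm_swaps ha
  exact costume_core ((zdGraph 3).comap (Subtype.val : ↥(box 3 N) → Site 3)) (boxPerm_adj_iff N (Equiv.swap (1 : Fin 3) 2))
    (boxPerm_adj_iff N (Equiv.swap (0 : Fin 3) 2)) h10 h11 h12 h13 h20 h21 h22 h23 ht

/-- `univ.image a = {a 0, a 1} ∪ {a 2, a 3}` for a `Fin 4`-indexed family. -/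
theorem image_univ_fin_four {W : Type*} [DecidableEq W] (a : Fin 4 → W) :
    (Finset.univ.image a : Finset W) = {a 0, a 1} ∪ {a 2, a 3} := by
  ext v
  simp only [Finset.mem_image, Finset.mem_univ, true_and, Finset.mem_union, Finset.mem_insert,
    Finset.mem_singleton]
  constructor
  · rintro ⟨i, rfl⟩
    fin_cases i <;> simp
  · rintro ((rfl | rfl) | (rfl | rfl)) <;> exact ⟨_, rfl⟩

/-- **COSTUME, kernel-checked half: the lattice clause (iii) at the tetrahedron implies the
junk-free crux**, with `c ↦ (2/3)·c`.  Chain: `LHS_clean = Zsp(a₂,a₃)` ((★), `pairSplit_identity`)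
`≤ Z_A / 3` (tetrahedral symmetry + handshake, `costume_core`) `= ⟨σ_A⟩ Z⁰ / 3` (HT expansion)
`≤ (3 - 2c) G₀₁ G₂₃ Z⁰ / 3` (INT + `G₀₂G₁₃ = G₀₃G₁₂ = G₀₁G₂₃`) `= (1 - (2/3)c) Z₀₁ G₂₃`. -/
theorem int_imp_strandShadowClean : INT → StrandShadowClean := by
  rintro ⟨c, hc, hINT⟩
  refine ⟨2 / 3 * c, by positivity, fun l hl => ?_⟩
  obtain ⟨N₀, hN⟩ := hINT l hl
  refine ⟨N₀, fun N hNN a ha => ?_⟩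
  have hI := hN N hNN a ha
  simp only at hI ⊢
  -- the two symmetries
  have hσ₁ := boxPerm_adj_iff N (Equiv.swap (1 : Fin 3) 2)
  have hσ₂ := boxPerm_adj_iff N (Equiv.swap (0 : Fin 3) 2)
  obtain ⟨f10, f11, f12, f13, f20, f21, f22, f23⟩ := tetra_swap_facts
  have h10 := boxPerm_tetra (N := N) ha f10
  have h11 := boxPerm_tetra (N := N) ha f11
  have h12 := boxPerm_tetra (N := N) ha f12
  have h13 := boxPerm_tetra (N := N) ha f13
  have h20 := boxPerm_tetra (N := N) ha f20
  have h21 := boxPerm_tetra (N := N) ha f21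
  have h22 := boxPerm_tetra (N := N) ha f22
  have h23 := boxPerm_tetra (N := N) ha f23
  have ht : 0 ≤ Real.tanh (criticalBeta 3) := tanh_criticalBeta_nonneg
  -- (★), folded
  have hstar := pairSplit_identity_zsp ((zdGraph 3).comap (Subtype.val : ↥(box 3 N) → Site 3)) (a 0) (a 1) (a 2) (a 3) (criticalBeta 3)
  -- 3 Zsp ≤ Z_A
  have hcore := costume_core ((zdGraph 3).comap (Subtype.val : ↥(box 3 N) → Site 3)) hσ₁ hσ₂ h10 h11 h12 h13 h20 h21 h22 h23 ht
  -- correlation symmetries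
  have g02 : isingCorr ((zdGraph 3).comap (Subtype.val : ↥(box 3 N) → Site 3)) Finset.univ (criticalBeta 3) 0 .free {a 0, a 2} =
      isingCorr ((zdGraph 3).comap (Subtype.val : ↥(box 3 N) → Site 3)) Finset.univ (criticalBeta 3) 0 .free {a 0, a 1} := by
    have := isingCorr_pair_transport ((zdGraph 3).comap (Subtype.val : ↥(box 3 N) → Site 3)) hσ₁ (criticalBeta 3) (a 0) (a 1)
    rwa [h10, h11] at this
  have g13 : isingCorr ((zdGraph 3).comap (Subtype.val : ↥(box 3 N) → Site 3)) Finset.univ (criticalBeta 3) 0 .free {a 1, a 3} =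
      isingCorr ((zdGraph 3).comap (Subtype.val : ↥(box 3 N) → Site 3)) Finset.univ (criticalBeta 3) 0 .free {a 2, a 3} := by
    have := isingCorr_pair_transport ((zdGraph 3).comap (Subtype.val : ↥(box 3 N) → Site 3)) hσ₁ (criticalBeta 3) (a 2) (a 3)
    rwa [h12, h13] at this
  have g03 : isingCorr ((zdGraph 3).comap (Subtype.val : ↥(box 3 N) → Site 3)) Finset.univ (criticalBeta 3) 0 .free {a 0, a 3} =
      isingCorr ((zdGraph 3).comap (Subtype.val : ↥(box 3 N) → Site 3)) Finset.univ (criticalBeta 3) 0 .free {a 0, a 1} := by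
    have := isingCorr_pair_transport ((zdGraph 3).comap (Subtype.val : ↥(box 3 N) → Site 3)) hσ₂ (criticalBeta 3) (a 0) (a 1)
    rwa [h20, h21] at this
  have g12 : isingCorr ((zdGraph 3).comap (Subtype.val : ↥(box 3 N) → Site 3)) Finset.univ (criticalBeta 3) 0 .free {a 1, a 2} =
      isingCorr ((zdGraph 3).comap (Subtype.val : ↥(box 3 N) → Site 3)) Finset.univ (criticalBeta 3) 0 .free {a 2, a 3} := by
    have := isingCorr_pair_transport ((zdGraph 3).comap (Subtype.val : ↥(box 3 N) → Site 3)) hσ₂ (criticalBeta 3) (a 2) (a 3)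
    rw [h22, h23, Finset.pair_comm] at this
    exact this
  -- HT expansions
  have hZ0 : 0 < loopO1PartitionFunction ((zdGraph 3).comap (Subtype.val : ↥(box 3 N) → Site 3)) (Real.tanh (criticalBeta 3)) ∅ :=
    loopO1PartitionFunction_empty_pos' ((zdGraph 3).comap (Subtype.val : ↥(box 3 N) → Site 3)) (criticalBeta 3)
  have hsA : isingCorr ((zdGraph 3).comap (Subtype.val : ↥(box 3 N) → Site 3)) Finset.univ (criticalBeta 3) 0 .free (Finset.univ.image a) *
      loopO1PartitionFunction ((zdGraph 3).comap (Subtype.val : ↥(box 3 N) → Site 3)) (Real.tanh (criticalBeta 3)) ∅ =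
      ∑ F ∈ tJoins ((zdGraph 3).comap (Subtype.val : ↥(box 3 N) → Site 3)) Set.univ ({a 0, a 1} ∪ {a 2, a 3}), Real.tanh (criticalBeta 3) ^ F.card := by
    rw [isingCorr_univ_free_eq_loopO1_div, image_univ_fin_four, div_mul_cancel₀ _ hZ0.ne',
      loopO1PartitionFunction_eq_sum_tJoins]
  have h01 : loopO1PartitionFunction ((zdGraph 3).comap (Subtype.val : ↥(box 3 N) → Site 3)) (Real.tanh (criticalBeta 3)) {a 0, a 1} =
      isingCorr ((zdGraph 3).comap (Subtype.val : ↥(box 3 N) → Site 3)) Finset.univ (criticalBeta 3) 0 .free {a 0, a 1} *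
        loopO1PartitionFunction ((zdGraph 3).comap (Subtype.val : ↥(box 3 N) → Site 3)) (Real.tanh (criticalBeta 3)) ∅ := by
    rw [isingCorr_univ_free_eq_loopO1_div, div_mul_cancel₀ _ hZ0.ne']
  -- rewrite INT with the symmetries
  rw [g02, g13, g03, g12] at hI
  rw [← hsA] at hcore
  have h1 : isingCorr ((zdGraph 3).comap (Subtype.val : ↥(box 3 N) → Site 3)) Finset.univ (criticalBeta 3) 0 .free (Finset.univ.image a) ≤
      (3 - 2 * c) * (isingCorr ((zdGraph 3).comap (Subtype.val : ↥(box 3 N) → Site 3)) Finset.univ (criticalBeta 3) 0 .free {a 0, a 1} *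
        isingCorr ((zdGraph 3).comap (Subtype.val : ↥(box 3 N) → Site 3)) Finset.univ (criticalBeta 3) 0 .free {a 2, a 3}) := by linarith
  have h2 := mul_le_mul_of_nonneg_right h1 hZ0.le
  have h3 := le_trans hcore h2
  have h4 : (1 - 2 / 3 * c) * loopO1PartitionFunction ((zdGraph 3).comap (Subtype.val : ↥(box 3 N) → Site 3)) (Real.tanh (criticalBeta 3)) {a 0, a 1} *
      isingCorr ((zdGraph 3).comap (Subtype.val : ↥(box 3 N) → Site 3)) Finset.univ (criticalBeta 3) 0 .free {a 2, a 3} =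
      ((3 - 2 * c) * (isingCorr ((zdGraph 3).comap (Subtype.val : ↥(box 3 N) → Site 3)) Finset.univ (criticalBeta 3) 0 .free {a 0, a 1} *
        isingCorr ((zdGraph 3).comap (Subtype.val : ↥(box 3 N) → Site 3)) Finset.univ (criticalBeta 3) 0 .free {a 2, a 3}) *
        loopO1PartitionFunction ((zdGraph 3).comap (Subtype.val : ↥(box 3 N) → Site 3)) (Real.tanh (criticalBeta 3)) ∅) / 3 := by
    rw [h01]; ring
  -- the bound in the generic lemmas' syntax …
  have key := hstar.trans_le
    (show _ ≤ (1 - 2 / 3 * c) * loopO1PartitionFunction ((zdGraph 3).comap (Subtype.val : ↥(box 3 N) → Site 3)) (Real.tanh (criticalBeta 3)) {a 0, a 1} *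
      isingCorr ((zdGraph 3).comap (Subtype.val : ↥(box 3 N) → Site 3)) Finset.univ (criticalBeta 3) 0 .free {a 2, a 3} by linarith [h3, h4])
  -- … transported to the crux's own elaboration (classical `Finset.filter` instances, raw
  -- reachability predicates): `convert`, never `exact` (see the note at `PairSplitDeletionIdentity`)
  convert key using 4
  ext v
  simp [dVol, Finset.mem_filter]

end Box

/-!
## MC (job j013016, this seat) — pure-python Swendsen–Wang at β_c = 0.221654626, free box `{-N..N}³`,
Edwards–Sokal bonds `ω`, EXACT uniform `T`-join sampler (spanning tree + fair coins on non-tree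
edges + leaf peeling; Grimmett–Janson with sources ⇒ law `ℓ^S_{tanh β}`), translation-averaged over
the central grid `{-T..T}³`, batch-means / jackknife errors (1σ in brackets); 4 cores × 25 min;
`compute-j013016.json` auto-attached to the item, raw block sums in `outputs/raw_l*_N*.json`.
`G = G₀₁` (all six `G_ij` agree within errors), `Int = -U₄/(2G₀₁G₂₃)` (spin side), `J/G₂₃` = junk
ratio `ℓ⁰¹[a₂,a₃ ∈ V(K₁)]/G₂₃`, `P_C = ℓ^A[all joined]`, `s_cl` = T-join-side clean shadow
`⟨σ_A⟩h₀₁/(G₀₁G₂₃)`, `s_sym = (1-(2/3)Int)(1-P_C)`, `s_f = s_cl + J/G₂₃` (formal), `r = φ[J]/(G₀₁G₂₃)`,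
`J₂ = ℓ⁰¹[a₂ ∈ V(K₁)]`.

  l  N   sweeps  G        Int        J/G₂₃      P_C        s_cl       s_sym      s_f       1-s_f     r        J₂
  1  8   86507   0.0901   0.472(2)   0.049(1)   0.081(1)   0.634(5)   0.630(1)   0.683(5)  0.317(5)  1.49(0)  0.0509(5)
  1  12  23455   0.0953   0.491(2)   0.050(3)   0.086(2)   0.618(10)  0.615(2)   0.668(10) 0.332(10) 1.50(1)  0.0531(10)
  2  12  29541   0.0395   0.430(7)   0.011(3)   0.053(4)   0.660(21)  0.676(5)   0.671(21) 0.329(21) 1.59(1)  0.0201(7)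
  2  16  10778   0.0434   0.451(7)   0.025(6)   0.060(7)   0.617(25)  0.657(6)   0.642(26) 0.358(26) 1.63(2)  0.0214(12)
  3  16  14911   0.0249   0.413(17)  0.017(9)   0.030(6)   0.726(42)  0.703(11)  0.743(42) 0.257(42) 1.64(3)  0.0113(11)
  3  20  6642    0.0268   0.415(17)  0.020(11)  0.049(10)  0.79(8)    0.688(14)  0.81(8)   0.19(8)   1.71(4)  0.0138(18)
  4  20  7262    0.0180   0.363(36)  0          0.054(19)  0.70(7)    0.717(25)  0.70(7)   0.30(7)   1.80(9)  0.0110(13)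
  4  24  3875    0.0189   0.422(20)  0          0.047(22)  0.75(9)    0.685(19)  0.75(9)   0.25(9)   1.69(5)  0.0068(15)

Readings. (i) JUNK: `J/G₂₃ ≤ 0.05` everywhere against a formal margin `1 - s_f ≈ 0.25–0.35`: the
misstatement does not bite at small `l` (and `J/G₂₃ → 0`). (ii) COSTUME CHECK: `s_cl = s_sym` within
≤ 1.6σ at every `(l,N)` — the identity (★) + symmetry on the lattice; `h₀₁ ≈ h₀₂ ≈ h₀₃ ≈ 0.31` at
`l = 1`. (iii) `Int(l)` (= clause (iii) itself) is `0.47, 0.44, 0.41, 0.36–0.42` for `l = 1..4` and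
RISES with `N` at fixed `l` (finite-size suppression), so nothing here hints at `Int → 0`; `l ≤ 4`
cannot separate a constant from a slow power, of course. (iv) `P_C` drifts down (`0.08 → 0.05`,
slope ≈ -0.3 in `log l`), consistent with the BLOB verdict `3 - x₄ < 0`; `r = φ[J]/G²` GROWS
(`1.5 → 1.7–1.8`), consistent with FKFourConnectivity. (v) `J₂(l) ∝ l^{-1.27}` (`0.051, 0.021,
0.012, 0.009`), i.e. the deleted cluster `K` has dimension `3 - 1.27 ≈ 1.73 = D_HT` — the route's
strand-dimension input, measured on its own object.
-/

end Summit.CriticalPhenomena.Ising3DConformalLimit.Cruxes.StrandShadow.Disproof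

end
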